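import Literature.AlgebraicGeometry.HodgeTheory.FermatShiodaCondition
import HarnessLib

/-!
# Shioda's condition `(Pₘ)` for the small composite degrees `m = 8, 9, 10`, and two structural remarks

Family `hodge`, layer `Literature/AlgebraicGeometry/HodgeTheory`. Sequel of `FermatShiodaCondition`
(Shioda's semigroup `Mₘ` as `FermatCharacter.IsHodgeMultiset`, the decomposability notions, the
condition `ShiodaCondition m = (Pₘ)`, the inductive spine `IsShiodaClosed.of_shiodaCondition` of
Shioda's Theorem 1, and `(Pₘ)` for `m` prime, `4`, `6`), continuing item 2) of the list after
Shioda's Theorem 1 — "The condition `(Pⁿₘ)` has been verified for … 2) `m ≤ 20`, all `n`" (Proc.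
Japan Acad. 55A (1979), §2, p. 112) — degree by degree, with kernel-checked proofs replacing the
hand verification. Everything here is PROVED; no geometry enters; no definition is introduced.

## What is proved

* `shiodaCondition_iff_indecomposable`, `shiodaConditionUpTo_iff_indecomposable` — `(Pₘ)`, `(Pⁿₘ)`
  in Shioda's own words: "`Mₘ` has no indecomposable elements of length `≥ 3` which are neither
  quasi-decomposable nor semi-decomposable" (PJA §1, `(Pⁿₘ(H))'`).
* `forall_of_isDecomposable_of_lt`, `shiodaCondition_of_upTo_of_isDecomposable_of_lt` — bounded
  generation, the mechanism of da Silva's Prop. 3.7 ("if the Hodge conjecture is true for `Xⁿₘ` for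
  all `n ≤ 2(φ(m) - 1)`, then it is true for `Xⁿₘ` and any `n`", `φ(m)` the largest length of an
  indecomposable of `Mₘ`): if all elements with more than `B` entries are decomposable, a family
  closed under juxtaposition and containing the non-empty Hodge multisets with `≤ B` entries
  contains them all, and `(Pⁿₘ)` for one `n ≥ B - 2` gives `(Pₘ)`.
* `shiodaCondition_eight` — **`(P₈)`**: the two norm equations (`t = 1, 3`) read
  `3x₁ + 2x₂ + x₃ = x₅ + 2x₆ + 3x₇`, `x₁ + 3x₃ + 2x₆ = 2x₂ + 3x₅ + x₇` (`count_of_eight`); off the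
  pairs and `{4,4}` a Hodge multiset is `x₁ · {1,5,6} + x₄ · {4}` (`x₄ ≤ 1`) or its negative, hence
  contains the indecomposable `{1,4,5,6}` (length `2`) or `{1,1,5,5,6,6}` (length `3`,
  quasi-decomposable `+ {4,4} = {1,4,5,6} + {1,4,5,6}` and semi-decomposable `{1,1,6} + {5,5,6}`),
  properly unless equal to the latter; `φ(8) = 3`.
* `shiodaCondition_nine` — **`(P₉)`**, through the first alternative only: three norm equations
  (`t = 1, 2, 4`); off the pairs a Hodge multiset is a multiple of `{1,4,6,7}` or of `{2,3,5,8}`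
  (`nine_shape₁`, `nine_shape₈`), so `M₉` has NO indecomposable of length `≥ 3`
  (`IsHodgeMultiset.isDecomposable_of_nine`; `φ(9) = 2`, Aoki's `φ(p²) = (p+1)/2` quoted by da Silva §3).
* `shiodaCondition_ten` — **`(P₁₀)`**: two norm equations (`t = 1, 3`); off the pairs and `{5,5}`
  a Hodge multiset lies in one of eight two-parameter families `a·T + b·Q (+ {5})` with
  `T ∈ {{1,6,8}, {2,4,9}, {2,6,7}, {3,4,8}}` a zero-sum triple and `Q ∈ {{1,3,8,8}, {1,6,6,7},
  {2,2,7,9}, {3,4,4,9}}` an indecomposable of length `2` compatible with it (`ten_arith₁`–`ten_arith₁₁`,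
  each a Presburger certificate discharged by `omega`), hence contains `Q`, `T + {5}` or `2·T` — the
  four indecomposables of length `3`, `2·T`, being quasi-decomposable (`+ {5,5} = (T+{5}) + (T+{5})`);
  `φ(10) = 3`.

Method (all three degrees): extract the multiplicities `xᵢ = count i s` and the norm equations
(`Finset.sum_multiset_map_count`), split off `{a, -a}` whenever a value occurs with its negative
(`IsHodgeMultiset.isDecomposable_of_pair`), and off the pairs let `omega` certify the shape of the
solution set of the norm equations under the sign pattern; the finitely many indecomposables that
appear are checked to be Hodge multisets by `decide`. The lists of indecomposables agree with a
brute-force enumeration (up to `12` entries) and, for the lengths, with da Silva's table and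
Conjecture 2 (`φ(2ˡ) = 2ˡ⁻² + 1`).

## What is NOT here

Nothing geometric (see the module docstring of `FermatShiodaCondition` for how `(Pₘ)` enters the
named fact `hodgeClasses_algebraic_fermat`). UPDATE 2026-08-15: `(Pₘ)` for the remaining
`m ∈ {12, 14, 15, 16, 18, 20}` of Shioda's list item 2, which this file left to "a generated
certificate rather than a hand analysis", is now PROVED that way in the sibling files
`FermatShiodaConditionTwelve`, `…Fourteen`, `…Fifteen`, `…Sixteen`, `…Eighteen`, `…Twenty`
(`FermatCharacter.shiodaCondition_twelve`, …, `shiodaCondition_twenty`: explicit Hilbert bases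
`hb12`, …, `hb20` certified complete by `linarith` decision trees, quasi-decomposition witnesses
checked by `decide`; `M₁₂` has `56` indecomposables of lengths up to `5` — so `φ(12) = 5`, not `4` as an
earlier bounded brute force suggested here —, `φ(14) = 3`, `φ(15) = 3`, `φ(16) = 5`, `φ(18) = 7`,
`φ(20) = 5`), and for da Silva's `m = 21, 27` in `FermatShiodaConditionTwentyOne`, `…TwentySeven`.
With `shiodaCondition_of_prime`, `shiodaCondition_four`, `shiodaCondition_six` (`FermatShiodaCondition`)
and the three degrees of this file, Shioda's condition is thus a theorem of the tree for every
`2 ≤ m ≤ 21` and for `m = 27` (it is false for `m = 25`: `not_shiodaCondition_twentyfive`).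

## References

* [Shioda1979PJA] T. Shioda, The Hodge conjecture and the Tate conjecture for Fermat varieties,
  Proc. Japan Acad. 55A (1979) 111–114: §1 (`Mₘ`, Definition (i)–(iii), `(Pⁿₘ)`, `(Pⁿₘ)'`), §2
  Thm. 1 and the list after it (item 2: `m ≤ 20`) (text read).
* [daSilva2021HodgeFermat] G. da Silva Jr., Notes on the Hodge Conjecture for Fermat Varieties,
  Experimental Results 2 (2021), arXiv:2101.04739: §2 Thm. 2.5–2.7, §3 Prop. 3.7, table of `φ(m)`,
  Conjecture 2 (text read).
* [GouveaYui1995] F. Q. Gouvêa, N. Yui, Arithmetic of Diagonal Hypersurfaces over Finite Fields,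
  LMS Lecture Note Series 209 (1995): closing sketch of Shioda's approach (text read).
-/

noncomputable section

open Finset Multiset

namespace Literature.AlgebraicGeometry.HodgeTheory

namespace FermatCharacter

variable {m : ℕ}

/-! ### Shioda's phrasing through indecomposables; bounded generation (da Silva Prop. 3.7) -/

/-- **`(Pₘ)` in Shioda's own words**: "`Mₘ` has no indecomposable elements of length `≥ 3` which are
neither quasi-decomposable nor semi-decomposable" — equivalent to `ShiodaCondition m`, the
decomposable elements being covered by its first alternative. [cite: Shioda1979PJA, §1 condition (Pⁿₘ(H))'] -/
theorem shiodaCondition_iff_indecomposable :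
    ShiodaCondition m ↔ ∀ s : Multiset (ZMod m), IsHodgeMultiset s → 6 ≤ card s →
      ¬ IsDecomposable s → IsQuasiDecomposable s ∨ IsSemiDecomposable s := by
  refine ⟨fun h s hs h6 hnd ↦ (h s hs h6).resolve_left hnd, fun h s hs h6 ↦ ?_⟩
  by_cases hd : IsDecomposable s
  · exact Or.inl hd
  · exact Or.inr (h s hs h6 hd)

/-- `(Pⁿₘ)` likewise. [cite: Shioda1979PJA, §1 condition (Pⁿₘ(H))] -/
theorem shiodaConditionUpTo_iff_indecomposable {n : ℕ} :
    ShiodaConditionUpTo m n ↔ ∀ s : Multiset (ZMod m), IsHodgeMultiset s → 6 ≤ card s →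
      card s ≤ n + 2 → ¬ IsDecomposable s → IsQuasiDecomposable s ∨ IsSemiDecomposable s := by
  refine ⟨fun h s hs h6 hn hnd ↦ (h s hs h6 hn).resolve_left hnd, fun h s hs h6 hn ↦ ?_⟩
  by_cases hd : IsDecomposable s
  · exact Or.inl hd
  · exact Or.inr (h s hs h6 hn hd)

/-- **Bounded generation** (the mechanism of da Silva's Prop. 3.7: "if the Hodge conjecture is true
for `Xⁿₘ` for all `n ≤ 2(φ(m) - 1)`, then it is true for `Xⁿₘ` and any `n`", `φ(m)` the largest
length of an indecomposable element of `Mₘ`): if every element of `Mₘ` with more than `B` elements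
is decomposable (all indecomposables have `≤ B` elements, i.e. `B ≥ 2φ(m)`), then a family
containing the non-empty Hodge multisets with `≤ B` elements and closed under juxtaposition contains
them all. [cite: daSilva2021HodgeFermat, Prop. 3.7] -/
theorem forall_of_isDecomposable_of_lt [NeZero m] {B : ℕ}
    (hB : ∀ s : Multiset (ZMod m), IsHodgeMultiset s → B < card s → IsDecomposable s)
    {C : Multiset (ZMod m) → Prop}
    (hbase : ∀ s : Multiset (ZMod m), s ≠ 0 → IsHodgeMultiset s → card s ≤ B → C s)
    (hstar : ∀ t u : Multiset (ZMod m), t ≠ 0 → u ≠ 0 → IsHodgeMultiset t → IsHodgeMultiset u →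
      C t → C u → C (t + u)) :
    ∀ s : Multiset (ZMod m), s ≠ 0 → IsHodgeMultiset s → C s := by
  suffices H : ∀ k, ∀ s : Multiset (ZMod m), card s = k → s ≠ 0 → IsHodgeMultiset s → C s from
    fun s ↦ H _ s rfl
  intro k
  induction k using Nat.strong_induction_on with
  | _ k ih =>
  intro s hk hs0 hs
  rcases le_or_gt (card s) B with hle | hlt
  · exact hbase s hs0 hs hle
  · obtain ⟨t, u, ht0, hu0, ht, hu, rfl⟩ := hB s hs hlt
    have hct : card t < card (t + u) := by
      rw [Multiset.card_add]; have := hu.two_le_card hu0; omega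
    have hcu : card u < card (t + u) := by
      rw [Multiset.card_add]; have := ht.two_le_card ht0; omega
    exact hstar t u ht0 hu0 ht hu (ih _ (hk ▸ hct) t rfl ht0 ht) (ih _ (hk ▸ hcu) u rfl hu0 hu)

/-- In particular, if all indecomposables have `≤ B` elements then `(Pⁿₘ)` for ONE `n` with
`n + 2 ≥ B` already gives `(Pₘ)` (elements longer than `B` are decomposable). [cite: daSilva2021HodgeFermat, Prop. 3.7] -/
theorem shiodaCondition_of_upTo_of_isDecomposable_of_lt {B n : ℕ} (hBn : B ≤ n + 2)
    (hB : ∀ s : Multiset (ZMod m), IsHodgeMultiset s → B < card s → IsDecomposable s)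
    (hP : ShiodaConditionUpTo m n) : ShiodaCondition m := fun s hs h6 ↦ by
  rcases le_or_gt (card s) (n + 2) with hle | hlt
  · exact hP s hs h6 hle
  · exact Or.inl (hB s hs (by omega))


/-! ### Degree `8`: two independent norm equations -/

section Eight

/-- **The semigroup `M₈`**: for a Hodge multiset over `ℤ/8` with multiplicities `xᵢ`, `x₀ = 0` and
the two norm equations for the units `t = 1` and `t = 3` read `3x₁ + 2x₂ + x₃ = x₅ + 2x₆ + 3x₇` and
`x₁ + 3x₃ + 2x₆ = 2x₂ + 3x₅ + x₇`. [cite: Shioda1979PJA, §1 eq. (2)] -/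
theorem IsHodgeMultiset.count_of_eight {s : Multiset (ZMod 8)} (h : IsHodgeMultiset s) :
    count 0 s = 0 ∧
      3 * count 1 s + 2 * count 2 s + count 3 s = count 5 s + 2 * count 6 s + 3 * count 7 s ∧
      count 1 s + 3 * count 3 s + 2 * count 6 s = 2 * count 2 s + 3 * count 5 s + count 7 s ∧
      card s = count 1 s + count 2 s + count 3 s + count 4 s + count 5 s + count 6 s +
        count 7 s := by
  have h0 : count 0 s = 0 := Multiset.count_eq_zero.2 fun h0 ↦ h.1.1 0 h0 rfl
  have huniv : (univ : Finset (ZMod 8)) = {0, 1, 2, 3, 4, 5, 6, 7} := by decide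
  have h0n : (0 : ZMod 8) ∉ ({1, 2, 3, 4, 5, 6, 7} : Finset (ZMod 8)) := by decide
  have h1n : (1 : ZMod 8) ∉ ({2, 3, 4, 5, 6, 7} : Finset (ZMod 8)) := by decide
  have h2n : (2 : ZMod 8) ∉ ({3, 4, 5, 6, 7} : Finset (ZMod 8)) := by decide
  have h3n : (3 : ZMod 8) ∉ ({4, 5, 6, 7} : Finset (ZMod 8)) := by decide
  have h4n : (4 : ZMod 8) ∉ ({5, 6, 7} : Finset (ZMod 8)) := by decide
  have h5n : (5 : ZMod 8) ∉ ({6, 7} : Finset (ZMod 8)) := by decide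
  have h6n : (6 : ZMod 8) ∉ ({7} : Finset (ZMod 8)) := by decide
  have h1v : (1 : ZMod 8).val = 1 := rfl
  have h2v : (2 : ZMod 8).val = 2 := rfl
  have h3v : (3 : ZMod 8).val = 3 := rfl
  have h4v : (4 : ZMod 8).val = 4 := rfl
  have h5v : (5 : ZMod 8).val = 5 := rfl
  have h6v : (6 : ZMod 8).val = 6 := rfl
  have h7v : (7 : ZMod 8).val = 7 := rfl
  have g0 : ((3 : ZMod 8) * 0).val = 0 := rfl
  have g1 : ((3 : ZMod 8) * 1).val = 3 := rfl
  have g2 : ((3 : ZMod 8) * 2).val = 6 := rfl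
  have g3 : ((3 : ZMod 8) * 3).val = 1 := rfl
  have g4 : ((3 : ZMod 8) * 4).val = 4 := rfl
  have g5 : ((3 : ZMod 8) * 5).val = 7 := rfl
  have g6 : ((3 : ZMod 8) * 6).val = 2 := rfl
  have g7 : ((3 : ZMod 8) * 7).val = 5 := rfl
  have hn := h.2 1
  simp only [Units.val_one, one_mul, Multiset.map_id'] at hn
  rw [mNormSum, sum_map_eq_sum_count_mul, card_eq_sum_count, huniv] at hn
  have hn3 := h.2 (Units.mkOfMulEqOne 3 3 (by decide))
  simp only [Units.val_mkOfMulEqOne] at hn3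
  rw [mNormSum, Multiset.map_map, Function.comp_def, sum_map_eq_sum_count_mul, card_eq_sum_count,
    huniv] at hn3
  have hc := card_eq_sum_count s
  rw [huniv] at hc
  simp only [Finset.sum_insert h0n, Finset.sum_insert h1n, Finset.sum_insert h2n,
    Finset.sum_insert h3n, Finset.sum_insert h4n, Finset.sum_insert h5n, Finset.sum_insert h6n,
    Finset.sum_singleton, h0, zero_mul, zero_add, h1v, h2v, h3v, h4v, h5v, h6v, h7v, g0, g1, g2,
    g3, g4, g5, g6, g7] at hn hn3 hc
  exact ⟨h0, by omega, by omega, by omega⟩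

/-- `{1,4,5,6}` (`(-3,-1) + (1,3) + (2,-2) = 0` in the two norm coordinates, plus a `4`) is a Hodge
multiset over `ℤ/8`, indecomposable of length `2`. [cite: Shioda1979PJA, §1] -/
theorem isHodgeMultiset_eight₁₄₅₆ : IsHodgeMultiset ({1, 4, 5, 6} : Multiset (ZMod 8)) := by
  unfold IsHodgeMultiset mNormSum; decide

/-- `{2,3,4,7} = -{1,4,5,6}` is a Hodge multiset over `ℤ/8`. [cite: Shioda1979PJA, §1] -/
theorem isHodgeMultiset_eight₂₃₄₇ : IsHodgeMultiset ({2, 3, 4, 7} : Multiset (ZMod 8)) := by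
  unfold IsHodgeMultiset mNormSum; decide

/-- `{1,1,5,5,6,6}` is a Hodge multiset over `ℤ/8` (an indecomposable of length `3`).
[cite: Shioda1979PJA, §2 Thm. 1, list item 2)] -/
theorem isHodgeMultiset_eight₁ : IsHodgeMultiset ({1, 1, 5, 5, 6, 6} : Multiset (ZMod 8)) := by
  unfold IsHodgeMultiset mNormSum; decide

/-- `{2,2,3,3,7,7}` is a Hodge multiset over `ℤ/8` (the other indecomposable of length `3`).
[cite: Shioda1979PJA, §2 Thm. 1, list item 2)] -/
theorem isHodgeMultiset_eight₇ : IsHodgeMultiset ({2, 2, 3, 3, 7, 7} : Multiset (ZMod 8)) := by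
  unfold IsHodgeMultiset mNormSum; decide

/-- `{1,1,5,5,6,6}` is quasi-decomposable: `+ {4,4} = {1,4,5,6} + {1,4,5,6}`.
[cite: Shioda1979PJA, §1 Definition (ii)] -/
theorem isQuasiDecomposable_eight₁ :
    IsQuasiDecomposable ({1, 1, 5, 5, 6, 6} : Multiset (ZMod 8)) :=
  ⟨4, by decide, {1, 4, 5, 6}, {1, 4, 5, 6}, by decide, by decide, isHodgeMultiset_eight₁₄₅₆,
    isHodgeMultiset_eight₁₄₅₆, by decide, by decide, by decide⟩

/-- `{2,2,3,3,7,7}` is quasi-decomposable: `+ {4,4} = {2,3,4,7} + {2,3,4,7}`.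
[cite: Shioda1979PJA, §1 Definition (ii)] -/
theorem isQuasiDecomposable_eight₇ :
    IsQuasiDecomposable ({2, 2, 3, 3, 7, 7} : Multiset (ZMod 8)) :=
  ⟨4, by decide, {2, 3, 4, 7}, {2, 3, 4, 7}, by decide, by decide, isHodgeMultiset_eight₂₃₄₇,
    isHodgeMultiset_eight₂₃₄₇, by decide, by decide, by decide⟩

/-- `{1,1,5,5,6,6}` is also semi-decomposable: `{1,1,6} + {5,5,6}`.
[cite: Shioda1979PJA, §1 Definition (iii)] -/
theorem isSemiDecomposable_eight₁ :
    IsSemiDecomposable ({1, 1, 5, 5, 6, 6} : Multiset (ZMod 8)) :=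
  ⟨{1, 1, 6}, {5, 5, 6}, rfl, rfl, by decide, by decide, by decide⟩

/-- **`(P₈)`** (within Shioda's `m ≤ 20`, PJA Thm. 1 list item 2): a Hodge multiset over `ℤ/8` with
`≥ 6` elements is decomposable unless it is `{1,1,5,5,6,6}` or `{2,2,3,3,7,7}`, which are
quasi-decomposable. Proof: split off `{4,4}` or a pair `{a,-a}` when possible; otherwise the two
norm equations leave only `x₁ = x₅ = x₆` (or `x₂ = x₃ = x₇`) with at most one `4`, i.e. a
multiple of `{1,5,6}` (`{2,3,7}`) plus possibly `{4}`, which contains `{1,4,5,6}` or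
`{1,1,5,5,6,6}` (their negatives), properly unless equal to the latter.
[cite: Shioda1979PJA, §2 Thm. 1, list item 2)] -/
theorem shiodaCondition_eight : ShiodaCondition 8 := by
  intro s hs h6
  obtain ⟨h0, hE1, hE2, hcard⟩ := hs.count_of_eight
  obtain ⟨j, hj⟩ := hs.even_card
  have hn1 : (-1 : ZMod 8) = 7 := by decide
  have hn2 : (-2 : ZMod 8) = 6 := by decide
  have hn3 : (-3 : ZMod 8) = 5 := by decide
  -- (a) two `4`s
  by_cases h4 : 2 ≤ count 4 s
  · refine Or.inl (hs.isDecomposable_of_pair (by omega) (a := 4)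
      (Multiset.count_pos.1 (by omega)) ?_)
    rw [if_pos (by decide)]
    exact h4
  -- (b)–(d) an opposite pair
  by_cases h17 : 1 ≤ count 1 s ∧ 1 ≤ count 7 s
  · refine Or.inl (hs.isDecomposable_of_pair (by omega) (a := 1)
      (Multiset.count_pos.1 (by omega)) ?_)
    rw [if_neg (by decide), hn1]
    exact Multiset.count_pos.1 (by omega)
  by_cases h26 : 1 ≤ count 2 s ∧ 1 ≤ count 6 s
  · refine Or.inl (hs.isDecomposable_of_pair (by omega) (a := 2)
      (Multiset.count_pos.1 (by omega)) ?_)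
    rw [if_neg (by decide), hn2]
    exact Multiset.count_pos.1 (by omega)
  by_cases h35 : 1 ≤ count 3 s ∧ 1 ≤ count 5 s
  · refine Or.inl (hs.isDecomposable_of_pair (by omega) (a := 3)
      (Multiset.count_pos.1 (by omega)) ?_)
    rw [if_neg (by decide), hn3]
    exact Multiset.count_pos.1 (by omega)
  have hcases : ∀ x : ZMod 8, x = 0 ∨ x = 1 ∨ x = 2 ∨ x = 3 ∨ x = 4 ∨ x = 5 ∨ x = 6 ∨ x = 7 := by
    decide
  -- (e) `x₁ ≥ 1`: `s = x₁ · {1,5,6} + x₄ · {4}`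
  by_cases hc1 : 1 ≤ count 1 s
  · have hc7 : count 7 s = 0 := by omega
    have hc3 : count 3 s = 0 := by omega
    have hc2 : count 2 s = 0 := by omega
    have hc5 : count 5 s = count 1 s := by omega
    have hc6 : count 6 s = count 1 s := by omega
    by_cases hc4 : count 4 s = 1
    · -- contains `{1,4,5,6}` properly
      refine Or.inl (hs.isDecomposable_of_le isHodgeMultiset_eight₁₄₅₆ (by decide) ?_ ?_)
      · refine Multiset.le_iff_count.2 fun a ↦ ?_
        rcases hcases a with rfl | rfl | rfl | rfl | rfl | rfl | rfl | rfl
        · rw [show count (0 : ZMod 8) ({1, 4, 5, 6} : Multiset (ZMod 8)) = 0 from by decide]; omega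
        · rw [show count (1 : ZMod 8) ({1, 4, 5, 6} : Multiset (ZMod 8)) = 1 from by decide]; omega
        · rw [show count (2 : ZMod 8) ({1, 4, 5, 6} : Multiset (ZMod 8)) = 0 from by decide]; omega
        · rw [show count (3 : ZMod 8) ({1, 4, 5, 6} : Multiset (ZMod 8)) = 0 from by decide]; omega
        · rw [show count (4 : ZMod 8) ({1, 4, 5, 6} : Multiset (ZMod 8)) = 1 from by decide]; omega
        · rw [show count (5 : ZMod 8) ({1, 4, 5, 6} : Multiset (ZMod 8)) = 1 from by decide]; omega
        · rw [show count (6 : ZMod 8) ({1, 4, 5, 6} : Multiset (ZMod 8)) = 1 from by decide]; omega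
        · rw [show count (7 : ZMod 8) ({1, 4, 5, 6} : Multiset (ZMod 8)) = 0 from by decide]; omega
      · show 4 < card s
        omega
    have hc4' : count 4 s = 0 := by omega
    by_cases hc1' : count 1 s = 2
    · have hsw : s = {1, 1, 5, 5, 6, 6} := by
        refine Multiset.ext' fun a ↦ ?_
        rcases hcases a with rfl | rfl | rfl | rfl | rfl | rfl | rfl | rfl
        · rw [h0]; decide
        · rw [hc1']; decide
        · rw [hc2]; decide
        · rw [hc3]; decide
        · rw [hc4']; decide
        · rw [hc5, hc1']; decide
        · rw [hc6, hc1']; decide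
        · rw [hc7]; decide
      rw [hsw]
      exact Or.inr (Or.inl isQuasiDecomposable_eight₁)
    · -- `x₁ ≥ 4`: contains `{1,1,5,5,6,6}` properly
      refine Or.inl (hs.isDecomposable_of_le isHodgeMultiset_eight₁ (by decide) ?_ ?_)
      · refine Multiset.le_iff_count.2 fun a ↦ ?_
        rcases hcases a with rfl | rfl | rfl | rfl | rfl | rfl | rfl | rfl
        · rw [show count (0 : ZMod 8) ({1, 1, 5, 5, 6, 6} : Multiset (ZMod 8)) = 0 from by decide]; omega
        · rw [show count (1 : ZMod 8) ({1, 1, 5, 5, 6, 6} : Multiset (ZMod 8)) = 2 from by decide]; omega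
        · rw [show count (2 : ZMod 8) ({1, 1, 5, 5, 6, 6} : Multiset (ZMod 8)) = 0 from by decide]; omega
        · rw [show count (3 : ZMod 8) ({1, 1, 5, 5, 6, 6} : Multiset (ZMod 8)) = 0 from by decide]; omega
        · rw [show count (4 : ZMod 8) ({1, 1, 5, 5, 6, 6} : Multiset (ZMod 8)) = 0 from by decide]; omega
        · rw [show count (5 : ZMod 8) ({1, 1, 5, 5, 6, 6} : Multiset (ZMod 8)) = 2 from by decide]; omega
        · rw [show count (6 : ZMod 8) ({1, 1, 5, 5, 6, 6} : Multiset (ZMod 8)) = 2 from by decide]; omega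
        · rw [show count (7 : ZMod 8) ({1, 1, 5, 5, 6, 6} : Multiset (ZMod 8)) = 0 from by decide]; omega
      · show 6 < card s
        omega
  -- (f) `x₇ ≥ 1`: `s = x₇ · {2,3,7} + x₄ · {4}`
  by_cases hc7 : 1 ≤ count 7 s
  · have hc1' : count 1 s = 0 := by omega
    have hc5 : count 5 s = 0 := by omega
    have hc6 : count 6 s = 0 := by omega
    have hc2 : count 2 s = count 7 s := by omega
    have hc3 : count 3 s = count 7 s := by omega
    by_cases hc4 : count 4 s = 1
    · refine Or.inl (hs.isDecomposable_of_le isHodgeMultiset_eight₂₃₄₇ (by decide) ?_ ?_)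
      · refine Multiset.le_iff_count.2 fun a ↦ ?_
        rcases hcases a with rfl | rfl | rfl | rfl | rfl | rfl | rfl | rfl
        · rw [show count (0 : ZMod 8) ({2, 3, 4, 7} : Multiset (ZMod 8)) = 0 from by decide]; omega
        · rw [show count (1 : ZMod 8) ({2, 3, 4, 7} : Multiset (ZMod 8)) = 0 from by decide]; omega
        · rw [show count (2 : ZMod 8) ({2, 3, 4, 7} : Multiset (ZMod 8)) = 1 from by decide]; omega
        · rw [show count (3 : ZMod 8) ({2, 3, 4, 7} : Multiset (ZMod 8)) = 1 from by decide]; omega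
        · rw [show count (4 : ZMod 8) ({2, 3, 4, 7} : Multiset (ZMod 8)) = 1 from by decide]; omega
        · rw [show count (5 : ZMod 8) ({2, 3, 4, 7} : Multiset (ZMod 8)) = 0 from by decide]; omega
        · rw [show count (6 : ZMod 8) ({2, 3, 4, 7} : Multiset (ZMod 8)) = 0 from by decide]; omega
        · rw [show count (7 : ZMod 8) ({2, 3, 4, 7} : Multiset (ZMod 8)) = 1 from by decide]; omega
      · show 4 < card s
        omega
    have hc4' : count 4 s = 0 := by omega
    by_cases hc7' : count 7 s = 2
    · have hsw : s = {2, 2, 3, 3, 7, 7} := by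
        refine Multiset.ext' fun a ↦ ?_
        rcases hcases a with rfl | rfl | rfl | rfl | rfl | rfl | rfl | rfl
        · rw [h0]; decide
        · rw [hc1']; decide
        · rw [hc2, hc7']; decide
        · rw [hc3, hc7']; decide
        · rw [hc4']; decide
        · rw [hc5]; decide
        · rw [hc6]; decide
        · rw [hc7']; decide
      rw [hsw]
      exact Or.inr (Or.inl isQuasiDecomposable_eight₇)
    · refine Or.inl (hs.isDecomposable_of_le isHodgeMultiset_eight₇ (by decide) ?_ ?_)
      · refine Multiset.le_iff_count.2 fun a ↦ ?_
        rcases hcases a with rfl | rfl | rfl | rfl | rfl | rfl | rfl | rfl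
        · rw [show count (0 : ZMod 8) ({2, 2, 3, 3, 7, 7} : Multiset (ZMod 8)) = 0 from by decide]; omega
        · rw [show count (1 : ZMod 8) ({2, 2, 3, 3, 7, 7} : Multiset (ZMod 8)) = 0 from by decide]; omega
        · rw [show count (2 : ZMod 8) ({2, 2, 3, 3, 7, 7} : Multiset (ZMod 8)) = 2 from by decide]; omega
        · rw [show count (3 : ZMod 8) ({2, 2, 3, 3, 7, 7} : Multiset (ZMod 8)) = 2 from by decide]; omega
        · rw [show count (4 : ZMod 8) ({2, 2, 3, 3, 7, 7} : Multiset (ZMod 8)) = 0 from by decide]; omega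
        · rw [show count (5 : ZMod 8) ({2, 2, 3, 3, 7, 7} : Multiset (ZMod 8)) = 0 from by decide]; omega
        · rw [show count (6 : ZMod 8) ({2, 2, 3, 3, 7, 7} : Multiset (ZMod 8)) = 0 from by decide]; omega
        · rw [show count (7 : ZMod 8) ({2, 2, 3, 3, 7, 7} : Multiset (ZMod 8)) = 2 from by decide]; omega
      · show 6 < card s
        omega
  -- (g) nothing left
  exfalso
  omega

end Eight


/-! ### Degree `9`: three norm equations, no indecomposable of length `≥ 3` -/

section Nine

/-- **The semigroup `M₉`**: `x₀ = 0` and the three norm equations for the units `t = 1, 2, 4`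
(`2 ∑ ⟨tν⟩ x_ν = 9 ∑ x_ν`). [cite: Shioda1979PJA, §1 eq. (2)] -/
theorem IsHodgeMultiset.count_of_nine {s : Multiset (ZMod 9)} (h : IsHodgeMultiset s) :
    count 0 s = 0 ∧
      2 * (count 1 s + 2 * count 2 s + 3 * count 3 s + 4 * count 4 s + 5 * count 5 s +
        6 * count 6 s + 7 * count 7 s + 8 * count 8 s) = 9 * card s ∧
      2 * (2 * count 1 s + 4 * count 2 s + 6 * count 3 s + 8 * count 4 s + count 5 s +
        3 * count 6 s + 5 * count 7 s + 7 * count 8 s) = 9 * card s ∧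
      2 * (4 * count 1 s + 8 * count 2 s + 3 * count 3 s + 7 * count 4 s + 2 * count 5 s +
        6 * count 6 s + count 7 s + 5 * count 8 s) = 9 * card s ∧
      card s = count 1 s + count 2 s + count 3 s + count 4 s + count 5 s + count 6 s +
        count 7 s + count 8 s := by
  have h0 : count 0 s = 0 := Multiset.count_eq_zero.2 fun h0 ↦ h.1.1 0 h0 rfl
  have huniv : (univ : Finset (ZMod 9)) = {0, 1, 2, 3, 4, 5, 6, 7, 8} := by decide
  have h0n : (0 : ZMod 9) ∉ ({1, 2, 3, 4, 5, 6, 7, 8} : Finset (ZMod 9)) := by decide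
  have h1n : (1 : ZMod 9) ∉ ({2, 3, 4, 5, 6, 7, 8} : Finset (ZMod 9)) := by decide
  have h2n : (2 : ZMod 9) ∉ ({3, 4, 5, 6, 7, 8} : Finset (ZMod 9)) := by decide
  have h3n : (3 : ZMod 9) ∉ ({4, 5, 6, 7, 8} : Finset (ZMod 9)) := by decide
  have h4n : (4 : ZMod 9) ∉ ({5, 6, 7, 8} : Finset (ZMod 9)) := by decide
  have h5n : (5 : ZMod 9) ∉ ({6, 7, 8} : Finset (ZMod 9)) := by decide
  have h6n : (6 : ZMod 9) ∉ ({7, 8} : Finset (ZMod 9)) := by decide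
  have h7n : (7 : ZMod 9) ∉ ({8} : Finset (ZMod 9)) := by decide
  have f0 : ((1 : ZMod 9) * 0).val = 0 := rfl
  have f1 : ((1 : ZMod 9) * 1).val = 1 := rfl
  have f2 : ((1 : ZMod 9) * 2).val = 2 := rfl
  have f3 : ((1 : ZMod 9) * 3).val = 3 := rfl
  have f4 : ((1 : ZMod 9) * 4).val = 4 := rfl
  have f5 : ((1 : ZMod 9) * 5).val = 5 := rfl
  have f6 : ((1 : ZMod 9) * 6).val = 6 := rfl
  have f7 : ((1 : ZMod 9) * 7).val = 7 := rfl
  have f8 : ((1 : ZMod 9) * 8).val = 8 := rfl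
  have g0 : ((2 : ZMod 9) * 0).val = 0 := rfl
  have g1 : ((2 : ZMod 9) * 1).val = 2 := rfl
  have g2 : ((2 : ZMod 9) * 2).val = 4 := rfl
  have g3 : ((2 : ZMod 9) * 3).val = 6 := rfl
  have g4 : ((2 : ZMod 9) * 4).val = 8 := rfl
  have g5 : ((2 : ZMod 9) * 5).val = 1 := rfl
  have g6 : ((2 : ZMod 9) * 6).val = 3 := rfl
  have g7 : ((2 : ZMod 9) * 7).val = 5 := rfl
  have g8 : ((2 : ZMod 9) * 8).val = 7 := rfl
  have k0 : ((4 : ZMod 9) * 0).val = 0 := rfl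
  have k1 : ((4 : ZMod 9) * 1).val = 4 := rfl
  have k2 : ((4 : ZMod 9) * 2).val = 8 := rfl
  have k3 : ((4 : ZMod 9) * 3).val = 3 := rfl
  have k4 : ((4 : ZMod 9) * 4).val = 7 := rfl
  have k5 : ((4 : ZMod 9) * 5).val = 2 := rfl
  have k6 : ((4 : ZMod 9) * 6).val = 6 := rfl
  have k7 : ((4 : ZMod 9) * 7).val = 1 := rfl
  have k8 : ((4 : ZMod 9) * 8).val = 5 := rfl
  have hn1 := h.2 (Units.mkOfMulEqOne 1 1 (by decide))
  have hn2 := h.2 (Units.mkOfMulEqOne 2 5 (by decide))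
  have hn4 := h.2 (Units.mkOfMulEqOne 4 7 (by decide))
  simp only [Units.val_mkOfMulEqOne] at hn1 hn2 hn4
  rw [mNormSum, Multiset.map_map, Function.comp_def, sum_map_eq_sum_count_mul, card_eq_sum_count,
    huniv] at hn1 hn2 hn4
  have hc := card_eq_sum_count s
  rw [huniv] at hc
  simp only [Finset.sum_insert h0n, Finset.sum_insert h1n, Finset.sum_insert h2n,
    Finset.sum_insert h3n, Finset.sum_insert h4n, Finset.sum_insert h5n, Finset.sum_insert h6n,
    Finset.sum_insert h7n, Finset.sum_singleton, h0, zero_mul, zero_add, f0, f1, f2, f3, f4, f5,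
    f6, f7, f8, g0, g1, g2, g3, g4, g5, g6, g7, g8, k0, k1, k2, k3, k4, k5, k6, k7, k8]
    at hn1 hn2 hn4 hc
  exact ⟨h0, by omega, by omega, by omega, by omega⟩

/-- `{1,4,6,7}` is a Hodge multiset over `ℤ/9` (with `{2,3,5,8}` the only indecomposables of `M₉`
besides the four pairs). [cite: Shioda1979PJA, §1] -/
theorem isHodgeMultiset_nine₁₄₆₇ : IsHodgeMultiset ({1, 4, 6, 7} : Multiset (ZMod 9)) := by
  unfold IsHodgeMultiset mNormSum; decide

/-- `{2,3,5,8} = -{1,4,6,7}` is a Hodge multiset over `ℤ/9`. [cite: Shioda1979PJA, §1] -/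
theorem isHodgeMultiset_nine₂₃₅₈ : IsHodgeMultiset ({2, 3, 5, 8} : Multiset (ZMod 9)) := by
  unfold IsHodgeMultiset mNormSum; decide

/-- The arithmetic of `M₉` off the pairs, first half: with no `8` and no value together with its
negative, the three norm equations force a multiple of `{1,4,6,7}`. [cite: Shioda1979PJA, §1 eq. (2)] -/
theorem nine_shape₁ {c1 c2 c3 c4 c5 c6 c7 c8 n : ℕ}
    (hE1 : 2 * (c1 + 2 * c2 + 3 * c3 + 4 * c4 + 5 * c5 + 6 * c6 + 7 * c7 + 8 * c8) = 9 * n)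
    (hE2 : 2 * (2 * c1 + 4 * c2 + 6 * c3 + 8 * c4 + c5 + 3 * c6 + 5 * c7 + 7 * c8) = 9 * n)
    (hE4 : 2 * (4 * c1 + 8 * c2 + 3 * c3 + 7 * c4 + 2 * c5 + 6 * c6 + c7 + 5 * c8) = 9 * n)
    (hcard : n = c1 + c2 + c3 + c4 + c5 + c6 + c7 + c8) (h6 : 6 ≤ n)
    (h8 : c8 = 0) (h27 : c2 = 0 ∨ c7 = 0) (h36 : c3 = 0 ∨ c6 = 0) (h45 : c4 = 0 ∨ c5 = 0) :
    c2 = 0 ∧ c3 = 0 ∧ c5 = 0 ∧ c4 = c1 ∧ c6 = c1 ∧ c7 = c1 ∧ 2 ≤ c1 := by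
  subst h8
  rcases h27 with h | h <;> rcases h36 with h' | h' <;> rcases h45 with h'' | h'' <;> omega

/-- The arithmetic of `M₉` off the pairs, second half: with no `1` and no value together with its
negative, the three norm equations force a multiple of `{2,3,5,8}`. [cite: Shioda1979PJA, §1 eq. (2)] -/
theorem nine_shape₈ {c1 c2 c3 c4 c5 c6 c7 c8 n : ℕ}
    (hE1 : 2 * (c1 + 2 * c2 + 3 * c3 + 4 * c4 + 5 * c5 + 6 * c6 + 7 * c7 + 8 * c8) = 9 * n)
    (hE2 : 2 * (2 * c1 + 4 * c2 + 6 * c3 + 8 * c4 + c5 + 3 * c6 + 5 * c7 + 7 * c8) = 9 * n)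
    (hE4 : 2 * (4 * c1 + 8 * c2 + 3 * c3 + 7 * c4 + 2 * c5 + 6 * c6 + c7 + 5 * c8) = 9 * n)
    (hcard : n = c1 + c2 + c3 + c4 + c5 + c6 + c7 + c8) (h6 : 6 ≤ n)
    (h1 : c1 = 0) (h27 : c2 = 0 ∨ c7 = 0) (h36 : c3 = 0 ∨ c6 = 0) (h45 : c4 = 0 ∨ c5 = 0) :
    c4 = 0 ∧ c6 = 0 ∧ c7 = 0 ∧ c2 = c8 ∧ c3 = c8 ∧ c5 = c8 ∧ 2 ≤ c8 := by
  subst h1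
  rcases h27 with h | h <;> rcases h36 with h' | h' <;> rcases h45 with h'' | h'' <;> omega

/-- **`M₉` has no indecomposable element of length `≥ 3`** (`φ(9) = 2`; Aoki: `φ(p²) = (p+1)/2`):
every Hodge multiset over `ℤ/9` with `≥ 6` elements is decomposable — off the pairs it is a
multiple of `{1,4,6,7}` or of `{2,3,5,8}`. [cite: daSilva2021HodgeFermat, §3 (φ(p²) = (p+1)/2, after Aoki)]
[cite: Shioda1979PJA, §2 Thm. 1, list item 2)] -/
theorem IsHodgeMultiset.isDecomposable_of_nine {s : Multiset (ZMod 9)} (hs : IsHodgeMultiset s)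
    (h6 : 6 ≤ card s) : IsDecomposable s := by
  obtain ⟨h0, hE1, hE2, hE4, hcard⟩ := hs.count_of_nine
  have hn1 : (-1 : ZMod 9) = 8 := by decide
  have hn2 : (-2 : ZMod 9) = 7 := by decide
  have hn3 : (-3 : ZMod 9) = 6 := by decide
  have hn4 : (-4 : ZMod 9) = 5 := by decide
  have h4 : 4 ≤ card s := by omega
  -- a value together with its negative: split off the pair
  by_cases h18 : 1 ≤ count 1 s ∧ 1 ≤ count 8 s
  · refine hs.isDecomposable_of_pair h4 (a := 1) (Multiset.count_pos.1 h18.1) ?_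
    rw [if_neg (by decide), hn1]
    exact Multiset.count_pos.1 h18.2
  have h18' : count 1 s = 0 ∨ count 8 s = 0 := by omega
  clear h18
  by_cases h27 : 1 ≤ count 2 s ∧ 1 ≤ count 7 s
  · refine hs.isDecomposable_of_pair h4 (a := 2) (Multiset.count_pos.1 h27.1) ?_
    rw [if_neg (by decide), hn2]
    exact Multiset.count_pos.1 h27.2
  have h27' : count 2 s = 0 ∨ count 7 s = 0 := by omega
  clear h27
  by_cases h36 : 1 ≤ count 3 s ∧ 1 ≤ count 6 s
  · refine hs.isDecomposable_of_pair h4 (a := 3) (Multiset.count_pos.1 h36.1) ?_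
    rw [if_neg (by decide), hn3]
    exact Multiset.count_pos.1 h36.2
  have h36' : count 3 s = 0 ∨ count 6 s = 0 := by omega
  clear h36
  by_cases h45 : 1 ≤ count 4 s ∧ 1 ≤ count 5 s
  · refine hs.isDecomposable_of_pair h4 (a := 4) (Multiset.count_pos.1 h45.1) ?_
    rw [if_neg (by decide), hn4]
    exact Multiset.count_pos.1 h45.2
  have h45' : count 4 s = 0 ∨ count 5 s = 0 := by omega
  clear h45
  -- off the pairs: a multiple of `{1,4,6,7}` or `{2,3,5,8}`, contained properly since `#s ≥ 6`
  have hcases : ∀ x : ZMod 9,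
      x = 0 ∨ x = 1 ∨ x = 2 ∨ x = 3 ∨ x = 4 ∨ x = 5 ∨ x = 6 ∨ x = 7 ∨ x = 8 := by decide
  rcases h18' with hc1 | hc8
  · obtain ⟨hc4, hc6, hc7, hc2, hc3, hc5, hc8⟩ := nine_shape₈ hE1 hE2 hE4 hcard h6 hc1 h27' h36' h45'
    clear hE1 hE2 hE4 h27' h36' h45'
    refine hs.isDecomposable_of_le isHodgeMultiset_nine₂₃₅₈ (by decide) ?_ (show 4 < card s by omega)
    refine Multiset.le_iff_count.2 fun a ↦ ?_
    rcases hcases a with rfl | rfl | rfl | rfl | rfl | rfl | rfl | rfl | rfl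
    · rw [show count (0 : ZMod 9) ({2, 3, 5, 8} : Multiset (ZMod 9)) = 0 from by decide]; omega
    · rw [show count (1 : ZMod 9) ({2, 3, 5, 8} : Multiset (ZMod 9)) = 0 from by decide]; omega
    · rw [show count (2 : ZMod 9) ({2, 3, 5, 8} : Multiset (ZMod 9)) = 1 from by decide]; omega
    · rw [show count (3 : ZMod 9) ({2, 3, 5, 8} : Multiset (ZMod 9)) = 1 from by decide]; omega
    · rw [show count (4 : ZMod 9) ({2, 3, 5, 8} : Multiset (ZMod 9)) = 0 from by decide]; omega
    · rw [show count (5 : ZMod 9) ({2, 3, 5, 8} : Multiset (ZMod 9)) = 1 from by decide]; omega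
    · rw [show count (6 : ZMod 9) ({2, 3, 5, 8} : Multiset (ZMod 9)) = 0 from by decide]; omega
    · rw [show count (7 : ZMod 9) ({2, 3, 5, 8} : Multiset (ZMod 9)) = 0 from by decide]; omega
    · rw [show count (8 : ZMod 9) ({2, 3, 5, 8} : Multiset (ZMod 9)) = 1 from by decide]; omega
  · obtain ⟨hc2, hc3, hc5, hc4, hc6, hc7, hc1⟩ := nine_shape₁ hE1 hE2 hE4 hcard h6 hc8 h27' h36' h45'
    clear hE1 hE2 hE4 h27' h36' h45'
    refine hs.isDecomposable_of_le isHodgeMultiset_nine₁₄₆₇ (by decide) ?_ (show 4 < card s by omega)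
    refine Multiset.le_iff_count.2 fun a ↦ ?_
    rcases hcases a with rfl | rfl | rfl | rfl | rfl | rfl | rfl | rfl | rfl
    · rw [show count (0 : ZMod 9) ({1, 4, 6, 7} : Multiset (ZMod 9)) = 0 from by decide]; omega
    · rw [show count (1 : ZMod 9) ({1, 4, 6, 7} : Multiset (ZMod 9)) = 1 from by decide]; omega
    · rw [show count (2 : ZMod 9) ({1, 4, 6, 7} : Multiset (ZMod 9)) = 0 from by decide]; omega
    · rw [show count (3 : ZMod 9) ({1, 4, 6, 7} : Multiset (ZMod 9)) = 0 from by decide]; omega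
    · rw [show count (4 : ZMod 9) ({1, 4, 6, 7} : Multiset (ZMod 9)) = 1 from by decide]; omega
    · rw [show count (5 : ZMod 9) ({1, 4, 6, 7} : Multiset (ZMod 9)) = 0 from by decide]; omega
    · rw [show count (6 : ZMod 9) ({1, 4, 6, 7} : Multiset (ZMod 9)) = 1 from by decide]; omega
    · rw [show count (7 : ZMod 9) ({1, 4, 6, 7} : Multiset (ZMod 9)) = 1 from by decide]; omega
    · rw [show count (8 : ZMod 9) ({1, 4, 6, 7} : Multiset (ZMod 9)) = 0 from by decide]; omega

/-- **`(P₉)`** (within Shioda's `m ≤ 20`, PJA Thm. 1 list item 2), vacuously through the first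
alternative: `M₉` has no indecomposable of length `≥ 3`. [cite: Shioda1979PJA, §2 Thm. 1, list item 2)] -/
theorem shiodaCondition_nine : ShiodaCondition 9 := fun _ hs h6 ↦
  Or.inl (hs.isDecomposable_of_nine h6)

end Nine



/-! ### Degree `10`: eight two-parameter families -/

section Ten

/-- **The semigroup `M₁₀`**: `x₀ = 0` and the two norm equations for the units `t = 1, 3`
(`2 ∑ ⟨tν⟩ x_ν = 10 ∑ x_ν`). [cite: Shioda1979PJA, §1 eq. (2)] -/
theorem IsHodgeMultiset.count_of_ten {s : Multiset (ZMod 10)} (h : IsHodgeMultiset s) :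
    count 0 s = 0 ∧
      2 * (count 1 s + 2 * count 2 s + 3 * count 3 s + 4 * count 4 s + 5 * count 5 s +
        6 * count 6 s + 7 * count 7 s + 8 * count 8 s + 9 * count 9 s) = 10 * card s ∧
      2 * (3 * count 1 s + 6 * count 2 s + 9 * count 3 s + 2 * count 4 s + 5 * count 5 s +
        8 * count 6 s + count 7 s + 4 * count 8 s + 7 * count 9 s) = 10 * card s ∧
      card s = count 1 s + count 2 s + count 3 s + count 4 s + count 5 s + count 6 s +
        count 7 s + count 8 s + count 9 s := by
  have h0 : count 0 s = 0 := Multiset.count_eq_zero.2 fun h0 ↦ h.1.1 0 h0 rfl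
  have huniv : (univ : Finset (ZMod 10)) = {0, 1, 2, 3, 4, 5, 6, 7, 8, 9} := by decide
  have h0n : (0 : ZMod 10) ∉ ({1, 2, 3, 4, 5, 6, 7, 8, 9} : Finset (ZMod 10)) := by decide
  have h1n : (1 : ZMod 10) ∉ ({2, 3, 4, 5, 6, 7, 8, 9} : Finset (ZMod 10)) := by decide
  have h2n : (2 : ZMod 10) ∉ ({3, 4, 5, 6, 7, 8, 9} : Finset (ZMod 10)) := by decide
  have h3n : (3 : ZMod 10) ∉ ({4, 5, 6, 7, 8, 9} : Finset (ZMod 10)) := by decide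
  have h4n : (4 : ZMod 10) ∉ ({5, 6, 7, 8, 9} : Finset (ZMod 10)) := by decide
  have h5n : (5 : ZMod 10) ∉ ({6, 7, 8, 9} : Finset (ZMod 10)) := by decide
  have h6n : (6 : ZMod 10) ∉ ({7, 8, 9} : Finset (ZMod 10)) := by decide
  have h7n : (7 : ZMod 10) ∉ ({8, 9} : Finset (ZMod 10)) := by decide
  have h8n : (8 : ZMod 10) ∉ ({9} : Finset (ZMod 10)) := by decide
  have f0 : ((1 : ZMod 10) * 0).val = 0 := rfl
  have f1 : ((1 : ZMod 10) * 1).val = 1 := rfl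
  have f2 : ((1 : ZMod 10) * 2).val = 2 := rfl
  have f3 : ((1 : ZMod 10) * 3).val = 3 := rfl
  have f4 : ((1 : ZMod 10) * 4).val = 4 := rfl
  have f5 : ((1 : ZMod 10) * 5).val = 5 := rfl
  have f6 : ((1 : ZMod 10) * 6).val = 6 := rfl
  have f7 : ((1 : ZMod 10) * 7).val = 7 := rfl
  have f8 : ((1 : ZMod 10) * 8).val = 8 := rfl
  have f9 : ((1 : ZMod 10) * 9).val = 9 := rfl
  have g0 : ((3 : ZMod 10) * 0).val = 0 := rfl
  have g1 : ((3 : ZMod 10) * 1).val = 3 := rfl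
  have g2 : ((3 : ZMod 10) * 2).val = 6 := rfl
  have g3 : ((3 : ZMod 10) * 3).val = 9 := rfl
  have g4 : ((3 : ZMod 10) * 4).val = 2 := rfl
  have g5 : ((3 : ZMod 10) * 5).val = 5 := rfl
  have g6 : ((3 : ZMod 10) * 6).val = 8 := rfl
  have g7 : ((3 : ZMod 10) * 7).val = 1 := rfl
  have g8 : ((3 : ZMod 10) * 8).val = 4 := rfl
  have g9 : ((3 : ZMod 10) * 9).val = 7 := rfl
  have hn1 := h.2 (Units.mkOfMulEqOne 1 1 (by decide))
  have hn3 := h.2 (Units.mkOfMulEqOne 3 7 (by decide))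
  simp only [Units.val_mkOfMulEqOne] at hn1 hn3
  rw [mNormSum, Multiset.map_map, Function.comp_def, sum_map_eq_sum_count_mul, card_eq_sum_count,
    huniv] at hn1 hn3
  have hc := card_eq_sum_count s
  rw [huniv] at hc
  simp only [Finset.sum_insert h0n, Finset.sum_insert h1n, Finset.sum_insert h2n,
    Finset.sum_insert h3n, Finset.sum_insert h4n, Finset.sum_insert h5n, Finset.sum_insert h6n,
    Finset.sum_insert h7n, Finset.sum_insert h8n, Finset.sum_singleton, h0, zero_mul, zero_add,
    f0, f1, f2, f3, f4, f5, f6, f7, f8, f9, g0, g1, g2, g3, g4, g5, g6, g7, g8, g9] at hn1 hn3 hc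
  exact ⟨h0, by omega, by omega, by omega⟩

/-- `Q₁ = {1, 3, 8, 8}` is a Hodge multiset over `ℤ/10` (an indecomposable of length `2`). [cite: Shioda1979PJA, §1] -/
theorem isHodgeMultiset_tenQ₁ : IsHodgeMultiset ({1, 3, 8, 8} : Multiset (ZMod 10)) := by
  unfold IsHodgeMultiset mNormSum; decide

/-- `T₁ + {5} = {1, 5, 6, 8}` is a Hodge multiset over `ℤ/10` (an indecomposable of length `2`). [cite: Shioda1979PJA, §1] -/
theorem isHodgeMultiset_tenT₁₅ : IsHodgeMultiset ({1, 5, 6, 8} : Multiset (ZMod 10)) := by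
  unfold IsHodgeMultiset mNormSum; decide

/-- `2·T₁ = {1, 1, 6, 6, 8, 8}` is a Hodge multiset over `ℤ/10` (an indecomposable of length `3`). [cite: Shioda1979PJA, §2 Thm. 1, list item 2)] -/
theorem isHodgeMultiset_tenT₁T₁ : IsHodgeMultiset ({1, 1, 6, 6, 8, 8} : Multiset (ZMod 10)) := by
  unfold IsHodgeMultiset mNormSum; decide

/-- `{1, 1, 6, 6, 8, 8}` is quasi-decomposable: `+ {5,5} = {1, 5, 6, 8} + {1, 5, 6, 8}`.
[cite: Shioda1979PJA, §1 Definition (ii)] -/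
theorem isQuasiDecomposable_tenT₁T₁ : IsQuasiDecomposable ({1, 1, 6, 6, 8, 8} : Multiset (ZMod 10)) :=
  ⟨5, by decide, {1, 5, 6, 8}, {1, 5, 6, 8}, by decide, by decide, isHodgeMultiset_tenT₁₅,
    isHodgeMultiset_tenT₁₅, by decide, by decide, by decide⟩

/-- `Q₂ = {1, 6, 6, 7}` is a Hodge multiset over `ℤ/10` (an indecomposable of length `2`). [cite: Shioda1979PJA, §1] -/
theorem isHodgeMultiset_tenQ₂ : IsHodgeMultiset ({1, 6, 6, 7} : Multiset (ZMod 10)) := by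
  unfold IsHodgeMultiset mNormSum; decide

/-- `T₂ + {5} = {2, 4, 5, 9}` is a Hodge multiset over `ℤ/10` (an indecomposable of length `2`). [cite: Shioda1979PJA, §1] -/
theorem isHodgeMultiset_tenT₂₅ : IsHodgeMultiset ({2, 4, 5, 9} : Multiset (ZMod 10)) := by
  unfold IsHodgeMultiset mNormSum; decide

/-- `2·T₂ = {2, 2, 4, 4, 9, 9}` is a Hodge multiset over `ℤ/10` (an indecomposable of length `3`). [cite: Shioda1979PJA, §2 Thm. 1, list item 2)] -/
theorem isHodgeMultiset_tenT₂T₂ : IsHodgeMultiset ({2, 2, 4, 4, 9, 9} : Multiset (ZMod 10)) := by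
  unfold IsHodgeMultiset mNormSum; decide

/-- `{2, 2, 4, 4, 9, 9}` is quasi-decomposable: `+ {5,5} = {2, 4, 5, 9} + {2, 4, 5, 9}`.
[cite: Shioda1979PJA, §1 Definition (ii)] -/
theorem isQuasiDecomposable_tenT₂T₂ : IsQuasiDecomposable ({2, 2, 4, 4, 9, 9} : Multiset (ZMod 10)) :=
  ⟨5, by decide, {2, 4, 5, 9}, {2, 4, 5, 9}, by decide, by decide, isHodgeMultiset_tenT₂₅,
    isHodgeMultiset_tenT₂₅, by decide, by decide, by decide⟩

/-- `Q₃ = {2, 2, 7, 9}` is a Hodge multiset over `ℤ/10` (an indecomposable of length `2`). [cite: Shioda1979PJA, §1] -/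
theorem isHodgeMultiset_tenQ₃ : IsHodgeMultiset ({2, 2, 7, 9} : Multiset (ZMod 10)) := by
  unfold IsHodgeMultiset mNormSum; decide

/-- `T₃ + {5} = {2, 5, 6, 7}` is a Hodge multiset over `ℤ/10` (an indecomposable of length `2`). [cite: Shioda1979PJA, §1] -/
theorem isHodgeMultiset_tenT₃₅ : IsHodgeMultiset ({2, 5, 6, 7} : Multiset (ZMod 10)) := by
  unfold IsHodgeMultiset mNormSum; decide

/-- `2·T₃ = {2, 2, 6, 6, 7, 7}` is a Hodge multiset over `ℤ/10` (an indecomposable of length `3`). [cite: Shioda1979PJA, §2 Thm. 1, list item 2)] -/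
theorem isHodgeMultiset_tenT₃T₃ : IsHodgeMultiset ({2, 2, 6, 6, 7, 7} : Multiset (ZMod 10)) := by
  unfold IsHodgeMultiset mNormSum; decide

/-- `{2, 2, 6, 6, 7, 7}` is quasi-decomposable: `+ {5,5} = {2, 5, 6, 7} + {2, 5, 6, 7}`.
[cite: Shioda1979PJA, §1 Definition (ii)] -/
theorem isQuasiDecomposable_tenT₃T₃ : IsQuasiDecomposable ({2, 2, 6, 6, 7, 7} : Multiset (ZMod 10)) :=
  ⟨5, by decide, {2, 5, 6, 7}, {2, 5, 6, 7}, by decide, by decide, isHodgeMultiset_tenT₃₅,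
    isHodgeMultiset_tenT₃₅, by decide, by decide, by decide⟩

/-- `Q₄ = {3, 4, 4, 9}` is a Hodge multiset over `ℤ/10` (an indecomposable of length `2`). [cite: Shioda1979PJA, §1] -/
theorem isHodgeMultiset_tenQ₄ : IsHodgeMultiset ({3, 4, 4, 9} : Multiset (ZMod 10)) := by
  unfold IsHodgeMultiset mNormSum; decide

/-- `T₄ + {5} = {3, 4, 5, 8}` is a Hodge multiset over `ℤ/10` (an indecomposable of length `2`). [cite: Shioda1979PJA, §1] -/
theorem isHodgeMultiset_tenT₄₅ : IsHodgeMultiset ({3, 4, 5, 8} : Multiset (ZMod 10)) := by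
  unfold IsHodgeMultiset mNormSum; decide

/-- `2·T₄ = {3, 3, 4, 4, 8, 8}` is a Hodge multiset over `ℤ/10` (an indecomposable of length `3`). [cite: Shioda1979PJA, §2 Thm. 1, list item 2)] -/
theorem isHodgeMultiset_tenT₄T₄ : IsHodgeMultiset ({3, 3, 4, 4, 8, 8} : Multiset (ZMod 10)) := by
  unfold IsHodgeMultiset mNormSum; decide

/-- `{3, 3, 4, 4, 8, 8}` is quasi-decomposable: `+ {5,5} = {3, 4, 5, 8} + {3, 4, 5, 8}`.
[cite: Shioda1979PJA, §1 Definition (ii)] -/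
theorem isQuasiDecomposable_tenT₄T₄ : IsQuasiDecomposable ({3, 3, 4, 4, 8, 8} : Multiset (ZMod 10)) :=
  ⟨5, by decide, {3, 4, 5, 8}, {3, 4, 5, 8}, by decide, by decide, isHodgeMultiset_tenT₄₅,
    isHodgeMultiset_tenT₄₅, by decide, by decide, by decide⟩

/-- Containment of `{1, 3, 8, 8}` from the multiplicities. [folklore] -/
theorem tenQ₁_le {s : Multiset (ZMod 10)} (h1 : 1 ≤ count 1 s) (h3 : 1 ≤ count 3 s) (h8 : 2 ≤ count 8 s) :
    ({1, 3, 8, 8} : Multiset (ZMod 10)) ≤ s := by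
  have hcases : ∀ x : ZMod 10, x = 0 ∨ x = 1 ∨ x = 2 ∨ x = 3 ∨ x = 4 ∨ x = 5 ∨ x = 6 ∨ x = 7 ∨
      x = 8 ∨ x = 9 := by decide
  refine Multiset.le_iff_count.2 fun a ↦ ?_
  rcases hcases a with rfl | rfl | rfl | rfl | rfl | rfl | rfl | rfl | rfl | rfl
  · rw [show count (0 : ZMod 10) ({1, 3, 8, 8} : Multiset (ZMod 10)) = 0 from by decide]; exact Nat.zero_le _
  · rw [show count (1 : ZMod 10) ({1, 3, 8, 8} : Multiset (ZMod 10)) = 1 from by decide]; exact h1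
  · rw [show count (2 : ZMod 10) ({1, 3, 8, 8} : Multiset (ZMod 10)) = 0 from by decide]; exact Nat.zero_le _
  · rw [show count (3 : ZMod 10) ({1, 3, 8, 8} : Multiset (ZMod 10)) = 1 from by decide]; exact h3
  · rw [show count (4 : ZMod 10) ({1, 3, 8, 8} : Multiset (ZMod 10)) = 0 from by decide]; exact Nat.zero_le _
  · rw [show count (5 : ZMod 10) ({1, 3, 8, 8} : Multiset (ZMod 10)) = 0 from by decide]; exact Nat.zero_le _
  · rw [show count (6 : ZMod 10) ({1, 3, 8, 8} : Multiset (ZMod 10)) = 0 from by decide]; exact Nat.zero_le _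
  · rw [show count (7 : ZMod 10) ({1, 3, 8, 8} : Multiset (ZMod 10)) = 0 from by decide]; exact Nat.zero_le _
  · rw [show count (8 : ZMod 10) ({1, 3, 8, 8} : Multiset (ZMod 10)) = 2 from by decide]; exact h8
  · rw [show count (9 : ZMod 10) ({1, 3, 8, 8} : Multiset (ZMod 10)) = 0 from by decide]; exact Nat.zero_le _

/-- Containment of `{1, 5, 6, 8}` from the multiplicities. [folklore] -/
theorem tenT₁₅_le {s : Multiset (ZMod 10)} (h1 : 1 ≤ count 1 s) (h5 : 1 ≤ count 5 s) (h6 : 1 ≤ count 6 s) (h8 : 1 ≤ count 8 s) :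
    ({1, 5, 6, 8} : Multiset (ZMod 10)) ≤ s := by
  have hcases : ∀ x : ZMod 10, x = 0 ∨ x = 1 ∨ x = 2 ∨ x = 3 ∨ x = 4 ∨ x = 5 ∨ x = 6 ∨ x = 7 ∨
      x = 8 ∨ x = 9 := by decide
  refine Multiset.le_iff_count.2 fun a ↦ ?_
  rcases hcases a with rfl | rfl | rfl | rfl | rfl | rfl | rfl | rfl | rfl | rfl
  · rw [show count (0 : ZMod 10) ({1, 5, 6, 8} : Multiset (ZMod 10)) = 0 from by decide]; exact Nat.zero_le _
  · rw [show count (1 : ZMod 10) ({1, 5, 6, 8} : Multiset (ZMod 10)) = 1 from by decide]; exact h1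
  · rw [show count (2 : ZMod 10) ({1, 5, 6, 8} : Multiset (ZMod 10)) = 0 from by decide]; exact Nat.zero_le _
  · rw [show count (3 : ZMod 10) ({1, 5, 6, 8} : Multiset (ZMod 10)) = 0 from by decide]; exact Nat.zero_le _
  · rw [show count (4 : ZMod 10) ({1, 5, 6, 8} : Multiset (ZMod 10)) = 0 from by decide]; exact Nat.zero_le _
  · rw [show count (5 : ZMod 10) ({1, 5, 6, 8} : Multiset (ZMod 10)) = 1 from by decide]; exact h5
  · rw [show count (6 : ZMod 10) ({1, 5, 6, 8} : Multiset (ZMod 10)) = 1 from by decide]; exact h6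
  · rw [show count (7 : ZMod 10) ({1, 5, 6, 8} : Multiset (ZMod 10)) = 0 from by decide]; exact Nat.zero_le _
  · rw [show count (8 : ZMod 10) ({1, 5, 6, 8} : Multiset (ZMod 10)) = 1 from by decide]; exact h8
  · rw [show count (9 : ZMod 10) ({1, 5, 6, 8} : Multiset (ZMod 10)) = 0 from by decide]; exact Nat.zero_le _

/-- Containment of `{1, 1, 6, 6, 8, 8}` from the multiplicities. [folklore] -/
theorem tenT₁T₁_le {s : Multiset (ZMod 10)} (h1 : 2 ≤ count 1 s) (h6 : 2 ≤ count 6 s) (h8 : 2 ≤ count 8 s) :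
    ({1, 1, 6, 6, 8, 8} : Multiset (ZMod 10)) ≤ s := by
  have hcases : ∀ x : ZMod 10, x = 0 ∨ x = 1 ∨ x = 2 ∨ x = 3 ∨ x = 4 ∨ x = 5 ∨ x = 6 ∨ x = 7 ∨
      x = 8 ∨ x = 9 := by decide
  refine Multiset.le_iff_count.2 fun a ↦ ?_
  rcases hcases a with rfl | rfl | rfl | rfl | rfl | rfl | rfl | rfl | rfl | rfl
  · rw [show count (0 : ZMod 10) ({1, 1, 6, 6, 8, 8} : Multiset (ZMod 10)) = 0 from by decide]; exact Nat.zero_le _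
  · rw [show count (1 : ZMod 10) ({1, 1, 6, 6, 8, 8} : Multiset (ZMod 10)) = 2 from by decide]; exact h1
  · rw [show count (2 : ZMod 10) ({1, 1, 6, 6, 8, 8} : Multiset (ZMod 10)) = 0 from by decide]; exact Nat.zero_le _
  · rw [show count (3 : ZMod 10) ({1, 1, 6, 6, 8, 8} : Multiset (ZMod 10)) = 0 from by decide]; exact Nat.zero_le _
  · rw [show count (4 : ZMod 10) ({1, 1, 6, 6, 8, 8} : Multiset (ZMod 10)) = 0 from by decide]; exact Nat.zero_le _
  · rw [show count (5 : ZMod 10) ({1, 1, 6, 6, 8, 8} : Multiset (ZMod 10)) = 0 from by decide]; exact Nat.zero_le _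
  · rw [show count (6 : ZMod 10) ({1, 1, 6, 6, 8, 8} : Multiset (ZMod 10)) = 2 from by decide]; exact h6
  · rw [show count (7 : ZMod 10) ({1, 1, 6, 6, 8, 8} : Multiset (ZMod 10)) = 0 from by decide]; exact Nat.zero_le _
  · rw [show count (8 : ZMod 10) ({1, 1, 6, 6, 8, 8} : Multiset (ZMod 10)) = 2 from by decide]; exact h8
  · rw [show count (9 : ZMod 10) ({1, 1, 6, 6, 8, 8} : Multiset (ZMod 10)) = 0 from by decide]; exact Nat.zero_le _

/-- Containment of `{1, 6, 6, 7}` from the multiplicities. [folklore] -/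
theorem tenQ₂_le {s : Multiset (ZMod 10)} (h1 : 1 ≤ count 1 s) (h6 : 2 ≤ count 6 s) (h7 : 1 ≤ count 7 s) :
    ({1, 6, 6, 7} : Multiset (ZMod 10)) ≤ s := by
  have hcases : ∀ x : ZMod 10, x = 0 ∨ x = 1 ∨ x = 2 ∨ x = 3 ∨ x = 4 ∨ x = 5 ∨ x = 6 ∨ x = 7 ∨
      x = 8 ∨ x = 9 := by decide
  refine Multiset.le_iff_count.2 fun a ↦ ?_
  rcases hcases a with rfl | rfl | rfl | rfl | rfl | rfl | rfl | rfl | rfl | rfl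
  · rw [show count (0 : ZMod 10) ({1, 6, 6, 7} : Multiset (ZMod 10)) = 0 from by decide]; exact Nat.zero_le _
  · rw [show count (1 : ZMod 10) ({1, 6, 6, 7} : Multiset (ZMod 10)) = 1 from by decide]; exact h1
  · rw [show count (2 : ZMod 10) ({1, 6, 6, 7} : Multiset (ZMod 10)) = 0 from by decide]; exact Nat.zero_le _
  · rw [show count (3 : ZMod 10) ({1, 6, 6, 7} : Multiset (ZMod 10)) = 0 from by decide]; exact Nat.zero_le _
  · rw [show count (4 : ZMod 10) ({1, 6, 6, 7} : Multiset (ZMod 10)) = 0 from by decide]; exact Nat.zero_le _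
  · rw [show count (5 : ZMod 10) ({1, 6, 6, 7} : Multiset (ZMod 10)) = 0 from by decide]; exact Nat.zero_le _
  · rw [show count (6 : ZMod 10) ({1, 6, 6, 7} : Multiset (ZMod 10)) = 2 from by decide]; exact h6
  · rw [show count (7 : ZMod 10) ({1, 6, 6, 7} : Multiset (ZMod 10)) = 1 from by decide]; exact h7
  · rw [show count (8 : ZMod 10) ({1, 6, 6, 7} : Multiset (ZMod 10)) = 0 from by decide]; exact Nat.zero_le _
  · rw [show count (9 : ZMod 10) ({1, 6, 6, 7} : Multiset (ZMod 10)) = 0 from by decide]; exact Nat.zero_le _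

/-- Containment of `{2, 4, 5, 9}` from the multiplicities. [folklore] -/
theorem tenT₂₅_le {s : Multiset (ZMod 10)} (h2 : 1 ≤ count 2 s) (h4 : 1 ≤ count 4 s) (h5 : 1 ≤ count 5 s) (h9 : 1 ≤ count 9 s) :
    ({2, 4, 5, 9} : Multiset (ZMod 10)) ≤ s := by
  have hcases : ∀ x : ZMod 10, x = 0 ∨ x = 1 ∨ x = 2 ∨ x = 3 ∨ x = 4 ∨ x = 5 ∨ x = 6 ∨ x = 7 ∨
      x = 8 ∨ x = 9 := by decide
  refine Multiset.le_iff_count.2 fun a ↦ ?_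
  rcases hcases a with rfl | rfl | rfl | rfl | rfl | rfl | rfl | rfl | rfl | rfl
  · rw [show count (0 : ZMod 10) ({2, 4, 5, 9} : Multiset (ZMod 10)) = 0 from by decide]; exact Nat.zero_le _
  · rw [show count (1 : ZMod 10) ({2, 4, 5, 9} : Multiset (ZMod 10)) = 0 from by decide]; exact Nat.zero_le _
  · rw [show count (2 : ZMod 10) ({2, 4, 5, 9} : Multiset (ZMod 10)) = 1 from by decide]; exact h2
  · rw [show count (3 : ZMod 10) ({2, 4, 5, 9} : Multiset (ZMod 10)) = 0 from by decide]; exact Nat.zero_le _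
  · rw [show count (4 : ZMod 10) ({2, 4, 5, 9} : Multiset (ZMod 10)) = 1 from by decide]; exact h4
  · rw [show count (5 : ZMod 10) ({2, 4, 5, 9} : Multiset (ZMod 10)) = 1 from by decide]; exact h5
  · rw [show count (6 : ZMod 10) ({2, 4, 5, 9} : Multiset (ZMod 10)) = 0 from by decide]; exact Nat.zero_le _
  · rw [show count (7 : ZMod 10) ({2, 4, 5, 9} : Multiset (ZMod 10)) = 0 from by decide]; exact Nat.zero_le _
  · rw [show count (8 : ZMod 10) ({2, 4, 5, 9} : Multiset (ZMod 10)) = 0 from by decide]; exact Nat.zero_le _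
  · rw [show count (9 : ZMod 10) ({2, 4, 5, 9} : Multiset (ZMod 10)) = 1 from by decide]; exact h9

/-- Containment of `{2, 2, 4, 4, 9, 9}` from the multiplicities. [folklore] -/
theorem tenT₂T₂_le {s : Multiset (ZMod 10)} (h2 : 2 ≤ count 2 s) (h4 : 2 ≤ count 4 s) (h9 : 2 ≤ count 9 s) :
    ({2, 2, 4, 4, 9, 9} : Multiset (ZMod 10)) ≤ s := by
  have hcases : ∀ x : ZMod 10, x = 0 ∨ x = 1 ∨ x = 2 ∨ x = 3 ∨ x = 4 ∨ x = 5 ∨ x = 6 ∨ x = 7 ∨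
      x = 8 ∨ x = 9 := by decide
  refine Multiset.le_iff_count.2 fun a ↦ ?_
  rcases hcases a with rfl | rfl | rfl | rfl | rfl | rfl | rfl | rfl | rfl | rfl
  · rw [show count (0 : ZMod 10) ({2, 2, 4, 4, 9, 9} : Multiset (ZMod 10)) = 0 from by decide]; exact Nat.zero_le _
  · rw [show count (1 : ZMod 10) ({2, 2, 4, 4, 9, 9} : Multiset (ZMod 10)) = 0 from by decide]; exact Nat.zero_le _
  · rw [show count (2 : ZMod 10) ({2, 2, 4, 4, 9, 9} : Multiset (ZMod 10)) = 2 from by decide]; exact h2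
  · rw [show count (3 : ZMod 10) ({2, 2, 4, 4, 9, 9} : Multiset (ZMod 10)) = 0 from by decide]; exact Nat.zero_le _
  · rw [show count (4 : ZMod 10) ({2, 2, 4, 4, 9, 9} : Multiset (ZMod 10)) = 2 from by decide]; exact h4
  · rw [show count (5 : ZMod 10) ({2, 2, 4, 4, 9, 9} : Multiset (ZMod 10)) = 0 from by decide]; exact Nat.zero_le _
  · rw [show count (6 : ZMod 10) ({2, 2, 4, 4, 9, 9} : Multiset (ZMod 10)) = 0 from by decide]; exact Nat.zero_le _
  · rw [show count (7 : ZMod 10) ({2, 2, 4, 4, 9, 9} : Multiset (ZMod 10)) = 0 from by decide]; exact Nat.zero_le _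
  · rw [show count (8 : ZMod 10) ({2, 2, 4, 4, 9, 9} : Multiset (ZMod 10)) = 0 from by decide]; exact Nat.zero_le _
  · rw [show count (9 : ZMod 10) ({2, 2, 4, 4, 9, 9} : Multiset (ZMod 10)) = 2 from by decide]; exact h9

/-- Containment of `{2, 2, 7, 9}` from the multiplicities. [folklore] -/
theorem tenQ₃_le {s : Multiset (ZMod 10)} (h2 : 2 ≤ count 2 s) (h7 : 1 ≤ count 7 s) (h9 : 1 ≤ count 9 s) :
    ({2, 2, 7, 9} : Multiset (ZMod 10)) ≤ s := by
  have hcases : ∀ x : ZMod 10, x = 0 ∨ x = 1 ∨ x = 2 ∨ x = 3 ∨ x = 4 ∨ x = 5 ∨ x = 6 ∨ x = 7 ∨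
      x = 8 ∨ x = 9 := by decide
  refine Multiset.le_iff_count.2 fun a ↦ ?_
  rcases hcases a with rfl | rfl | rfl | rfl | rfl | rfl | rfl | rfl | rfl | rfl
  · rw [show count (0 : ZMod 10) ({2, 2, 7, 9} : Multiset (ZMod 10)) = 0 from by decide]; exact Nat.zero_le _
  · rw [show count (1 : ZMod 10) ({2, 2, 7, 9} : Multiset (ZMod 10)) = 0 from by decide]; exact Nat.zero_le _
  · rw [show count (2 : ZMod 10) ({2, 2, 7, 9} : Multiset (ZMod 10)) = 2 from by decide]; exact h2
  · rw [show count (3 : ZMod 10) ({2, 2, 7, 9} : Multiset (ZMod 10)) = 0 from by decide]; exact Nat.zero_le _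
  · rw [show count (4 : ZMod 10) ({2, 2, 7, 9} : Multiset (ZMod 10)) = 0 from by decide]; exact Nat.zero_le _
  · rw [show count (5 : ZMod 10) ({2, 2, 7, 9} : Multiset (ZMod 10)) = 0 from by decide]; exact Nat.zero_le _
  · rw [show count (6 : ZMod 10) ({2, 2, 7, 9} : Multiset (ZMod 10)) = 0 from by decide]; exact Nat.zero_le _
  · rw [show count (7 : ZMod 10) ({2, 2, 7, 9} : Multiset (ZMod 10)) = 1 from by decide]; exact h7
  · rw [show count (8 : ZMod 10) ({2, 2, 7, 9} : Multiset (ZMod 10)) = 0 from by decide]; exact Nat.zero_le _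
  · rw [show count (9 : ZMod 10) ({2, 2, 7, 9} : Multiset (ZMod 10)) = 1 from by decide]; exact h9

/-- Containment of `{2, 5, 6, 7}` from the multiplicities. [folklore] -/
theorem tenT₃₅_le {s : Multiset (ZMod 10)} (h2 : 1 ≤ count 2 s) (h5 : 1 ≤ count 5 s) (h6 : 1 ≤ count 6 s) (h7 : 1 ≤ count 7 s) :
    ({2, 5, 6, 7} : Multiset (ZMod 10)) ≤ s := by
  have hcases : ∀ x : ZMod 10, x = 0 ∨ x = 1 ∨ x = 2 ∨ x = 3 ∨ x = 4 ∨ x = 5 ∨ x = 6 ∨ x = 7 ∨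
      x = 8 ∨ x = 9 := by decide
  refine Multiset.le_iff_count.2 fun a ↦ ?_
  rcases hcases a with rfl | rfl | rfl | rfl | rfl | rfl | rfl | rfl | rfl | rfl
  · rw [show count (0 : ZMod 10) ({2, 5, 6, 7} : Multiset (ZMod 10)) = 0 from by decide]; exact Nat.zero_le _
  · rw [show count (1 : ZMod 10) ({2, 5, 6, 7} : Multiset (ZMod 10)) = 0 from by decide]; exact Nat.zero_le _
  · rw [show count (2 : ZMod 10) ({2, 5, 6, 7} : Multiset (ZMod 10)) = 1 from by decide]; exact h2
  · rw [show count (3 : ZMod 10) ({2, 5, 6, 7} : Multiset (ZMod 10)) = 0 from by decide]; exact Nat.zero_le _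
  · rw [show count (4 : ZMod 10) ({2, 5, 6, 7} : Multiset (ZMod 10)) = 0 from by decide]; exact Nat.zero_le _
  · rw [show count (5 : ZMod 10) ({2, 5, 6, 7} : Multiset (ZMod 10)) = 1 from by decide]; exact h5
  · rw [show count (6 : ZMod 10) ({2, 5, 6, 7} : Multiset (ZMod 10)) = 1 from by decide]; exact h6
  · rw [show count (7 : ZMod 10) ({2, 5, 6, 7} : Multiset (ZMod 10)) = 1 from by decide]; exact h7
  · rw [show count (8 : ZMod 10) ({2, 5, 6, 7} : Multiset (ZMod 10)) = 0 from by decide]; exact Nat.zero_le _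
  · rw [show count (9 : ZMod 10) ({2, 5, 6, 7} : Multiset (ZMod 10)) = 0 from by decide]; exact Nat.zero_le _

/-- Containment of `{2, 2, 6, 6, 7, 7}` from the multiplicities. [folklore] -/
theorem tenT₃T₃_le {s : Multiset (ZMod 10)} (h2 : 2 ≤ count 2 s) (h6 : 2 ≤ count 6 s) (h7 : 2 ≤ count 7 s) :
    ({2, 2, 6, 6, 7, 7} : Multiset (ZMod 10)) ≤ s := by
  have hcases : ∀ x : ZMod 10, x = 0 ∨ x = 1 ∨ x = 2 ∨ x = 3 ∨ x = 4 ∨ x = 5 ∨ x = 6 ∨ x = 7 ∨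
      x = 8 ∨ x = 9 := by decide
  refine Multiset.le_iff_count.2 fun a ↦ ?_
  rcases hcases a with rfl | rfl | rfl | rfl | rfl | rfl | rfl | rfl | rfl | rfl
  · rw [show count (0 : ZMod 10) ({2, 2, 6, 6, 7, 7} : Multiset (ZMod 10)) = 0 from by decide]; exact Nat.zero_le _
  · rw [show count (1 : ZMod 10) ({2, 2, 6, 6, 7, 7} : Multiset (ZMod 10)) = 0 from by decide]; exact Nat.zero_le _
  · rw [show count (2 : ZMod 10) ({2, 2, 6, 6, 7, 7} : Multiset (ZMod 10)) = 2 from by decide]; exact h2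
  · rw [show count (3 : ZMod 10) ({2, 2, 6, 6, 7, 7} : Multiset (ZMod 10)) = 0 from by decide]; exact Nat.zero_le _
  · rw [show count (4 : ZMod 10) ({2, 2, 6, 6, 7, 7} : Multiset (ZMod 10)) = 0 from by decide]; exact Nat.zero_le _
  · rw [show count (5 : ZMod 10) ({2, 2, 6, 6, 7, 7} : Multiset (ZMod 10)) = 0 from by decide]; exact Nat.zero_le _
  · rw [show count (6 : ZMod 10) ({2, 2, 6, 6, 7, 7} : Multiset (ZMod 10)) = 2 from by decide]; exact h6
  · rw [show count (7 : ZMod 10) ({2, 2, 6, 6, 7, 7} : Multiset (ZMod 10)) = 2 from by decide]; exact h7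
  · rw [show count (8 : ZMod 10) ({2, 2, 6, 6, 7, 7} : Multiset (ZMod 10)) = 0 from by decide]; exact Nat.zero_le _
  · rw [show count (9 : ZMod 10) ({2, 2, 6, 6, 7, 7} : Multiset (ZMod 10)) = 0 from by decide]; exact Nat.zero_le _

/-- Containment of `{3, 4, 4, 9}` from the multiplicities. [folklore] -/
theorem tenQ₄_le {s : Multiset (ZMod 10)} (h3 : 1 ≤ count 3 s) (h4 : 2 ≤ count 4 s) (h9 : 1 ≤ count 9 s) :
    ({3, 4, 4, 9} : Multiset (ZMod 10)) ≤ s := by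
  have hcases : ∀ x : ZMod 10, x = 0 ∨ x = 1 ∨ x = 2 ∨ x = 3 ∨ x = 4 ∨ x = 5 ∨ x = 6 ∨ x = 7 ∨
      x = 8 ∨ x = 9 := by decide
  refine Multiset.le_iff_count.2 fun a ↦ ?_
  rcases hcases a with rfl | rfl | rfl | rfl | rfl | rfl | rfl | rfl | rfl | rfl
  · rw [show count (0 : ZMod 10) ({3, 4, 4, 9} : Multiset (ZMod 10)) = 0 from by decide]; exact Nat.zero_le _
  · rw [show count (1 : ZMod 10) ({3, 4, 4, 9} : Multiset (ZMod 10)) = 0 from by decide]; exact Nat.zero_le _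
  · rw [show count (2 : ZMod 10) ({3, 4, 4, 9} : Multiset (ZMod 10)) = 0 from by decide]; exact Nat.zero_le _
  · rw [show count (3 : ZMod 10) ({3, 4, 4, 9} : Multiset (ZMod 10)) = 1 from by decide]; exact h3
  · rw [show count (4 : ZMod 10) ({3, 4, 4, 9} : Multiset (ZMod 10)) = 2 from by decide]; exact h4
  · rw [show count (5 : ZMod 10) ({3, 4, 4, 9} : Multiset (ZMod 10)) = 0 from by decide]; exact Nat.zero_le _
  · rw [show count (6 : ZMod 10) ({3, 4, 4, 9} : Multiset (ZMod 10)) = 0 from by decide]; exact Nat.zero_le _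
  · rw [show count (7 : ZMod 10) ({3, 4, 4, 9} : Multiset (ZMod 10)) = 0 from by decide]; exact Nat.zero_le _
  · rw [show count (8 : ZMod 10) ({3, 4, 4, 9} : Multiset (ZMod 10)) = 0 from by decide]; exact Nat.zero_le _
  · rw [show count (9 : ZMod 10) ({3, 4, 4, 9} : Multiset (ZMod 10)) = 1 from by decide]; exact h9

/-- Containment of `{3, 4, 5, 8}` from the multiplicities. [folklore] -/
theorem tenT₄₅_le {s : Multiset (ZMod 10)} (h3 : 1 ≤ count 3 s) (h4 : 1 ≤ count 4 s) (h5 : 1 ≤ count 5 s) (h8 : 1 ≤ count 8 s) :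
    ({3, 4, 5, 8} : Multiset (ZMod 10)) ≤ s := by
  have hcases : ∀ x : ZMod 10, x = 0 ∨ x = 1 ∨ x = 2 ∨ x = 3 ∨ x = 4 ∨ x = 5 ∨ x = 6 ∨ x = 7 ∨
      x = 8 ∨ x = 9 := by decide
  refine Multiset.le_iff_count.2 fun a ↦ ?_
  rcases hcases a with rfl | rfl | rfl | rfl | rfl | rfl | rfl | rfl | rfl | rfl
  · rw [show count (0 : ZMod 10) ({3, 4, 5, 8} : Multiset (ZMod 10)) = 0 from by decide]; exact Nat.zero_le _
  · rw [show count (1 : ZMod 10) ({3, 4, 5, 8} : Multiset (ZMod 10)) = 0 from by decide]; exact Nat.zero_le _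
  · rw [show count (2 : ZMod 10) ({3, 4, 5, 8} : Multiset (ZMod 10)) = 0 from by decide]; exact Nat.zero_le _
  · rw [show count (3 : ZMod 10) ({3, 4, 5, 8} : Multiset (ZMod 10)) = 1 from by decide]; exact h3
  · rw [show count (4 : ZMod 10) ({3, 4, 5, 8} : Multiset (ZMod 10)) = 1 from by decide]; exact h4
  · rw [show count (5 : ZMod 10) ({3, 4, 5, 8} : Multiset (ZMod 10)) = 1 from by decide]; exact h5
  · rw [show count (6 : ZMod 10) ({3, 4, 5, 8} : Multiset (ZMod 10)) = 0 from by decide]; exact Nat.zero_le _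
  · rw [show count (7 : ZMod 10) ({3, 4, 5, 8} : Multiset (ZMod 10)) = 0 from by decide]; exact Nat.zero_le _
  · rw [show count (8 : ZMod 10) ({3, 4, 5, 8} : Multiset (ZMod 10)) = 1 from by decide]; exact h8
  · rw [show count (9 : ZMod 10) ({3, 4, 5, 8} : Multiset (ZMod 10)) = 0 from by decide]; exact Nat.zero_le _

/-- Containment of `{3, 3, 4, 4, 8, 8}` from the multiplicities. [folklore] -/
theorem tenT₄T₄_le {s : Multiset (ZMod 10)} (h3 : 2 ≤ count 3 s) (h4 : 2 ≤ count 4 s) (h8 : 2 ≤ count 8 s) :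
    ({3, 3, 4, 4, 8, 8} : Multiset (ZMod 10)) ≤ s := by
  have hcases : ∀ x : ZMod 10, x = 0 ∨ x = 1 ∨ x = 2 ∨ x = 3 ∨ x = 4 ∨ x = 5 ∨ x = 6 ∨ x = 7 ∨
      x = 8 ∨ x = 9 := by decide
  refine Multiset.le_iff_count.2 fun a ↦ ?_
  rcases hcases a with rfl | rfl | rfl | rfl | rfl | rfl | rfl | rfl | rfl | rfl
  · rw [show count (0 : ZMod 10) ({3, 3, 4, 4, 8, 8} : Multiset (ZMod 10)) = 0 from by decide]; exact Nat.zero_le _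
  · rw [show count (1 : ZMod 10) ({3, 3, 4, 4, 8, 8} : Multiset (ZMod 10)) = 0 from by decide]; exact Nat.zero_le _
  · rw [show count (2 : ZMod 10) ({3, 3, 4, 4, 8, 8} : Multiset (ZMod 10)) = 0 from by decide]; exact Nat.zero_le _
  · rw [show count (3 : ZMod 10) ({3, 3, 4, 4, 8, 8} : Multiset (ZMod 10)) = 2 from by decide]; exact h3
  · rw [show count (4 : ZMod 10) ({3, 3, 4, 4, 8, 8} : Multiset (ZMod 10)) = 2 from by decide]; exact h4
  · rw [show count (5 : ZMod 10) ({3, 3, 4, 4, 8, 8} : Multiset (ZMod 10)) = 0 from by decide]; exact Nat.zero_le _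
  · rw [show count (6 : ZMod 10) ({3, 3, 4, 4, 8, 8} : Multiset (ZMod 10)) = 0 from by decide]; exact Nat.zero_le _
  · rw [show count (7 : ZMod 10) ({3, 3, 4, 4, 8, 8} : Multiset (ZMod 10)) = 0 from by decide]; exact Nat.zero_le _
  · rw [show count (8 : ZMod 10) ({3, 3, 4, 4, 8, 8} : Multiset (ZMod 10)) = 2 from by decide]; exact h8
  · rw [show count (9 : ZMod 10) ({3, 3, 4, 4, 8, 8} : Multiset (ZMod 10)) = 0 from by decide]; exact Nat.zero_le _

/-- Off the pairs, a multiple of `{1, 6, 8}` plus at most one `5`, with `≥ 6` elements, is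
decomposable or equal to `{1, 1, 6, 6, 8, 8}` (quasi-decomposable). [cite: Shioda1979PJA, §2 Thm. 1, list item 2)] -/
theorem ten_pureT₁ {s : Multiset (ZMod 10)} (hs : IsHodgeMultiset s) (h6 : 6 ≤ card s)
    (h0 : count 0 s = 0) (h5 : count 5 s ≤ 1)
    (hcard : card s = count 1 s + count 2 s + count 3 s + count 4 s + count 5 s + count 6 s +
      count 7 s + count 8 s + count 9 s)
    (hz2 : count 2 s = 0) (hz3 : count 3 s = 0) (hz4 : count 4 s = 0) (hz7 : count 7 s = 0) (hz9 : count 9 s = 0)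
    (he6 : count 6 s = count 1 s) (he8 : count 8 s = count 1 s) :
    IsDecomposable s ∨ IsQuasiDecomposable s ∨ IsSemiDecomposable s := by
  obtain ⟨j, hj⟩ := hs.even_card
  by_cases h5' : count 5 s = 1
  · exact Or.inl (hs.isDecomposable_of_le isHodgeMultiset_tenT₁₅ (by decide)
      (tenT₁₅_le (by omega) (by omega) (by omega) (by omega)) (show 4 < card s by omega))
  have h5'' : count 5 s = 0 := by omega
  by_cases ha : count 1 s = 2
  · have hcases : ∀ x : ZMod 10, x = 0 ∨ x = 1 ∨ x = 2 ∨ x = 3 ∨ x = 4 ∨ x = 5 ∨ x = 6 ∨ x = 7 ∨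
        x = 8 ∨ x = 9 := by decide
    have hsw : s = {1, 1, 6, 6, 8, 8} := by
      refine Multiset.ext' fun a ↦ ?_
      rcases hcases a with rfl | rfl | rfl | rfl | rfl | rfl | rfl | rfl | rfl | rfl
      · rw [h0]; decide
      · rw [ha]; decide
      · rw [hz2]; decide
      · rw [hz3]; decide
      · rw [hz4]; decide
      · rw [h5'']; decide
      · rw [he6, ha]; decide
      · rw [hz7]; decide
      · rw [he8, ha]; decide
      · rw [hz9]; decide
    rw [hsw]
    exact Or.inr (Or.inl isQuasiDecomposable_tenT₁T₁)
  · exact Or.inl (hs.isDecomposable_of_le isHodgeMultiset_tenT₁T₁ (by decide)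
      (tenT₁T₁_le (by omega) (by omega) (by omega)) (show 6 < card s by omega))

/-- Off the pairs, a multiple of `{2, 4, 9}` plus at most one `5`, with `≥ 6` elements, is
decomposable or equal to `{2, 2, 4, 4, 9, 9}` (quasi-decomposable). [cite: Shioda1979PJA, §2 Thm. 1, list item 2)] -/
theorem ten_pureT₂ {s : Multiset (ZMod 10)} (hs : IsHodgeMultiset s) (h6 : 6 ≤ card s)
    (h0 : count 0 s = 0) (h5 : count 5 s ≤ 1)
    (hcard : card s = count 1 s + count 2 s + count 3 s + count 4 s + count 5 s + count 6 s +
      count 7 s + count 8 s + count 9 s)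
    (hz1 : count 1 s = 0) (hz3 : count 3 s = 0) (hz6 : count 6 s = 0) (hz7 : count 7 s = 0) (hz8 : count 8 s = 0)
    (he4 : count 4 s = count 2 s) (he9 : count 9 s = count 2 s) :
    IsDecomposable s ∨ IsQuasiDecomposable s ∨ IsSemiDecomposable s := by
  obtain ⟨j, hj⟩ := hs.even_card
  by_cases h5' : count 5 s = 1
  · exact Or.inl (hs.isDecomposable_of_le isHodgeMultiset_tenT₂₅ (by decide)
      (tenT₂₅_le (by omega) (by omega) (by omega) (by omega)) (show 4 < card s by omega))
  have h5'' : count 5 s = 0 := by omega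
  by_cases ha : count 2 s = 2
  · have hcases : ∀ x : ZMod 10, x = 0 ∨ x = 1 ∨ x = 2 ∨ x = 3 ∨ x = 4 ∨ x = 5 ∨ x = 6 ∨ x = 7 ∨
        x = 8 ∨ x = 9 := by decide
    have hsw : s = {2, 2, 4, 4, 9, 9} := by
      refine Multiset.ext' fun a ↦ ?_
      rcases hcases a with rfl | rfl | rfl | rfl | rfl | rfl | rfl | rfl | rfl | rfl
      · rw [h0]; decide
      · rw [hz1]; decide
      · rw [ha]; decide
      · rw [hz3]; decide
      · rw [he4, ha]; decide
      · rw [h5'']; decide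
      · rw [hz6]; decide
      · rw [hz7]; decide
      · rw [hz8]; decide
      · rw [he9, ha]; decide
    rw [hsw]
    exact Or.inr (Or.inl isQuasiDecomposable_tenT₂T₂)
  · exact Or.inl (hs.isDecomposable_of_le isHodgeMultiset_tenT₂T₂ (by decide)
      (tenT₂T₂_le (by omega) (by omega) (by omega)) (show 6 < card s by omega))

/-- Off the pairs, a multiple of `{2, 6, 7}` plus at most one `5`, with `≥ 6` elements, is
decomposable or equal to `{2, 2, 6, 6, 7, 7}` (quasi-decomposable). [cite: Shioda1979PJA, §2 Thm. 1, list item 2)] -/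
theorem ten_pureT₃ {s : Multiset (ZMod 10)} (hs : IsHodgeMultiset s) (h6 : 6 ≤ card s)
    (h0 : count 0 s = 0) (h5 : count 5 s ≤ 1)
    (hcard : card s = count 1 s + count 2 s + count 3 s + count 4 s + count 5 s + count 6 s +
      count 7 s + count 8 s + count 9 s)
    (hz1 : count 1 s = 0) (hz3 : count 3 s = 0) (hz4 : count 4 s = 0) (hz8 : count 8 s = 0) (hz9 : count 9 s = 0)
    (he6 : count 6 s = count 2 s) (he7 : count 7 s = count 2 s) :
    IsDecomposable s ∨ IsQuasiDecomposable s ∨ IsSemiDecomposable s := by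
  obtain ⟨j, hj⟩ := hs.even_card
  by_cases h5' : count 5 s = 1
  · exact Or.inl (hs.isDecomposable_of_le isHodgeMultiset_tenT₃₅ (by decide)
      (tenT₃₅_le (by omega) (by omega) (by omega) (by omega)) (show 4 < card s by omega))
  have h5'' : count 5 s = 0 := by omega
  by_cases ha : count 2 s = 2
  · have hcases : ∀ x : ZMod 10, x = 0 ∨ x = 1 ∨ x = 2 ∨ x = 3 ∨ x = 4 ∨ x = 5 ∨ x = 6 ∨ x = 7 ∨
        x = 8 ∨ x = 9 := by decide
    have hsw : s = {2, 2, 6, 6, 7, 7} := by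
      refine Multiset.ext' fun a ↦ ?_
      rcases hcases a with rfl | rfl | rfl | rfl | rfl | rfl | rfl | rfl | rfl | rfl
      · rw [h0]; decide
      · rw [hz1]; decide
      · rw [ha]; decide
      · rw [hz3]; decide
      · rw [hz4]; decide
      · rw [h5'']; decide
      · rw [he6, ha]; decide
      · rw [he7, ha]; decide
      · rw [hz8]; decide
      · rw [hz9]; decide
    rw [hsw]
    exact Or.inr (Or.inl isQuasiDecomposable_tenT₃T₃)
  · exact Or.inl (hs.isDecomposable_of_le isHodgeMultiset_tenT₃T₃ (by decide)
      (tenT₃T₃_le (by omega) (by omega) (by omega)) (show 6 < card s by omega))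

/-- Off the pairs, a multiple of `{3, 4, 8}` plus at most one `5`, with `≥ 6` elements, is
decomposable or equal to `{3, 3, 4, 4, 8, 8}` (quasi-decomposable). [cite: Shioda1979PJA, §2 Thm. 1, list item 2)] -/
theorem ten_pureT₄ {s : Multiset (ZMod 10)} (hs : IsHodgeMultiset s) (h6 : 6 ≤ card s)
    (h0 : count 0 s = 0) (h5 : count 5 s ≤ 1)
    (hcard : card s = count 1 s + count 2 s + count 3 s + count 4 s + count 5 s + count 6 s +
      count 7 s + count 8 s + count 9 s)
    (hz1 : count 1 s = 0) (hz2 : count 2 s = 0) (hz6 : count 6 s = 0) (hz7 : count 7 s = 0) (hz9 : count 9 s = 0)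
    (he4 : count 4 s = count 3 s) (he8 : count 8 s = count 3 s) :
    IsDecomposable s ∨ IsQuasiDecomposable s ∨ IsSemiDecomposable s := by
  obtain ⟨j, hj⟩ := hs.even_card
  by_cases h5' : count 5 s = 1
  · exact Or.inl (hs.isDecomposable_of_le isHodgeMultiset_tenT₄₅ (by decide)
      (tenT₄₅_le (by omega) (by omega) (by omega) (by omega)) (show 4 < card s by omega))
  have h5'' : count 5 s = 0 := by omega
  by_cases ha : count 3 s = 2
  · have hcases : ∀ x : ZMod 10, x = 0 ∨ x = 1 ∨ x = 2 ∨ x = 3 ∨ x = 4 ∨ x = 5 ∨ x = 6 ∨ x = 7 ∨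
        x = 8 ∨ x = 9 := by decide
    have hsw : s = {3, 3, 4, 4, 8, 8} := by
      refine Multiset.ext' fun a ↦ ?_
      rcases hcases a with rfl | rfl | rfl | rfl | rfl | rfl | rfl | rfl | rfl | rfl
      · rw [h0]; decide
      · rw [hz1]; decide
      · rw [hz2]; decide
      · rw [ha]; decide
      · rw [he4, ha]; decide
      · rw [h5'']; decide
      · rw [hz6]; decide
      · rw [hz7]; decide
      · rw [he8, ha]; decide
      · rw [hz9]; decide
    rw [hsw]
    exact Or.inr (Or.inl isQuasiDecomposable_tenT₄T₄)
  · exact Or.inl (hs.isDecomposable_of_le isHodgeMultiset_tenT₄T₄ (by decide)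
      (tenT₄T₄_le (by omega) (by omega) (by omega)) (show 6 < card s by omega))

/-- The arithmetic of `M₁₀` off the pairs, `x₁, x₆, x₃ ≥ 1`: family `T₁ + Q₁` with `b ≥ 1`, so `x₈ ≥ 2`. [cite: Shioda1979PJA, §1 eq. (2)] -/
theorem ten_arith₁ {c1 c2 c3 c4 c5 c6 c7 c8 c9 n : ℕ}
    (hE1 : 2 * (c1 + 2 * c2 + 3 * c3 + 4 * c4 + 5 * c5 + 6 * c6 + 7 * c7 + 8 * c8 + 9 * c9) = 10 * n)
    (hE3 : 2 * (3 * c1 + 6 * c2 + 9 * c3 + 2 * c4 + 5 * c5 + 8 * c6 + c7 + 4 * c8 + 7 * c9) = 10 * n)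
    (hcard : n = c1 + c2 + c3 + c4 + c5 + c6 + c7 + c8 + c9) (h6 : 6 ≤ n) (h5 : c5 ≤ 1)
    (h19 : c1 = 0 ∨ c9 = 0) (h28 : c2 = 0 ∨ c8 = 0) (h37 : c3 = 0 ∨ c7 = 0) (h46 : c4 = 0 ∨ c6 = 0)
    (hc1 : 1 ≤ c1) (hc6 : 1 ≤ c6) (hc3 : 1 ≤ c3) : 2 ≤ c8 := by
  rcases h19 with hA | hA <;> rcases h28 with hB | hB <;> rcases h37 with hC | hC <;>
    rcases h46 with hD | hD <;> omega

/-- The arithmetic of `M₁₀` off the pairs, `x₁, x₆, x₇ ≥ 1`, `x₃ = 0`: `Q₂` occurs, so `x₆ ≥ 2`. [cite: Shioda1979PJA, §1 eq. (2)] -/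
theorem ten_arith₂ {c1 c2 c3 c4 c5 c6 c7 c8 c9 n : ℕ}
    (hE1 : 2 * (c1 + 2 * c2 + 3 * c3 + 4 * c4 + 5 * c5 + 6 * c6 + 7 * c7 + 8 * c8 + 9 * c9) = 10 * n)
    (hE3 : 2 * (3 * c1 + 6 * c2 + 9 * c3 + 2 * c4 + 5 * c5 + 8 * c6 + c7 + 4 * c8 + 7 * c9) = 10 * n)
    (hcard : n = c1 + c2 + c3 + c4 + c5 + c6 + c7 + c8 + c9) (h6 : 6 ≤ n) (h5 : c5 ≤ 1)
    (h19 : c1 = 0 ∨ c9 = 0) (h28 : c2 = 0 ∨ c8 = 0) (h37 : c3 = 0 ∨ c7 = 0) (h46 : c4 = 0 ∨ c6 = 0)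
    (hc1 : 1 ≤ c1) (hc6 : 1 ≤ c6) (hc3 : ¬1 ≤ c3) (hc7 : 1 ≤ c7) : 2 ≤ c6 := by
  rcases h19 with hA | hA <;> rcases h28 with hB | hB <;> rcases h37 with hC | hC <;>
    rcases h46 with hD | hD <;> omega

/-- The arithmetic of `M₁₀` off the pairs, `x₁, x₆ ≥ 1`, `x₃ = x₇ = 0`: a multiple of `T₁ = {1,6,8}` (plus `5`s). [cite: Shioda1979PJA, §1 eq. (2)] -/
theorem ten_arith₃ {c1 c2 c3 c4 c5 c6 c7 c8 c9 n : ℕ}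
    (hE1 : 2 * (c1 + 2 * c2 + 3 * c3 + 4 * c4 + 5 * c5 + 6 * c6 + 7 * c7 + 8 * c8 + 9 * c9) = 10 * n)
    (hE3 : 2 * (3 * c1 + 6 * c2 + 9 * c3 + 2 * c4 + 5 * c5 + 8 * c6 + c7 + 4 * c8 + 7 * c9) = 10 * n)
    (hcard : n = c1 + c2 + c3 + c4 + c5 + c6 + c7 + c8 + c9) (_h6 : 6 ≤ n) (_h5 : c5 ≤ 1)
    (h19 : c1 = 0 ∨ c9 = 0) (h28 : c2 = 0 ∨ c8 = 0) (h37 : c3 = 0 ∨ c7 = 0) (h46 : c4 = 0 ∨ c6 = 0)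
    (hc1 : 1 ≤ c1) (hc6 : 1 ≤ c6) (hc3 : ¬1 ≤ c3) (hc7 : ¬1 ≤ c7) : c2 = 0 ∧ c3 = 0 ∧ c4 = 0 ∧ c7 = 0 ∧ c9 = 0 ∧ c6 = c1 ∧ c8 = c1 := by
  rcases h19 with hA | hA <;> rcases h28 with hB | hB <;> rcases h37 with hC | hC <;>
    rcases h46 with hD | hD <;> omega

/-- The arithmetic of `M₁₀` off the pairs, `x₁ ≥ 1`, `x₆ = 0`: `Q₁` occurs. [cite: Shioda1979PJA, §1 eq. (2)] -/
theorem ten_arith₄ {c1 c2 c3 c4 c5 c6 c7 c8 c9 n : ℕ}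
    (hE1 : 2 * (c1 + 2 * c2 + 3 * c3 + 4 * c4 + 5 * c5 + 6 * c6 + 7 * c7 + 8 * c8 + 9 * c9) = 10 * n)
    (hE3 : 2 * (3 * c1 + 6 * c2 + 9 * c3 + 2 * c4 + 5 * c5 + 8 * c6 + c7 + 4 * c8 + 7 * c9) = 10 * n)
    (hcard : n = c1 + c2 + c3 + c4 + c5 + c6 + c7 + c8 + c9) (h6 : 6 ≤ n) (h5 : c5 ≤ 1)
    (h19 : c1 = 0 ∨ c9 = 0) (h28 : c2 = 0 ∨ c8 = 0) (h37 : c3 = 0 ∨ c7 = 0) (h46 : c4 = 0 ∨ c6 = 0)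
    (hc1 : 1 ≤ c1) (hc6 : ¬1 ≤ c6) : 1 ≤ c3 ∧ 2 ≤ c8 := by
  rcases h19 with hA | hA <;> rcases h28 with hB | hB <;> rcases h37 with hC | hC <;>
    rcases h46 with hD | hD <;> omega

/-- The arithmetic of `M₁₀` off the pairs, `x₉, x₄, x₇ ≥ 1`: `Q₃` occurs, so `x₂ ≥ 2`. [cite: Shioda1979PJA, §1 eq. (2)] -/
theorem ten_arith₅ {c1 c2 c3 c4 c5 c6 c7 c8 c9 n : ℕ}
    (hE1 : 2 * (c1 + 2 * c2 + 3 * c3 + 4 * c4 + 5 * c5 + 6 * c6 + 7 * c7 + 8 * c8 + 9 * c9) = 10 * n)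
    (hE3 : 2 * (3 * c1 + 6 * c2 + 9 * c3 + 2 * c4 + 5 * c5 + 8 * c6 + c7 + 4 * c8 + 7 * c9) = 10 * n)
    (hcard : n = c1 + c2 + c3 + c4 + c5 + c6 + c7 + c8 + c9) (h6 : 6 ≤ n) (h5 : c5 ≤ 1)
    (h19 : c1 = 0 ∨ c9 = 0) (h28 : c2 = 0 ∨ c8 = 0) (h37 : c3 = 0 ∨ c7 = 0) (h46 : c4 = 0 ∨ c6 = 0)
    (hc1 : ¬1 ≤ c1) (hc9 : 1 ≤ c9) (hc4 : 1 ≤ c4) (hc7 : 1 ≤ c7) : 2 ≤ c2 := by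
  rcases h19 with hA | hA <;> rcases h28 with hB | hB <;> rcases h37 with hC | hC <;>
    rcases h46 with hD | hD <;> omega

/-- The arithmetic of `M₁₀` off the pairs, `x₉, x₄, x₃ ≥ 1`, `x₇ = 0`: `Q₄` occurs, so `x₄ ≥ 2`. [cite: Shioda1979PJA, §1 eq. (2)] -/
theorem ten_arith₆ {c1 c2 c3 c4 c5 c6 c7 c8 c9 n : ℕ}
    (hE1 : 2 * (c1 + 2 * c2 + 3 * c3 + 4 * c4 + 5 * c5 + 6 * c6 + 7 * c7 + 8 * c8 + 9 * c9) = 10 * n)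
    (hE3 : 2 * (3 * c1 + 6 * c2 + 9 * c3 + 2 * c4 + 5 * c5 + 8 * c6 + c7 + 4 * c8 + 7 * c9) = 10 * n)
    (hcard : n = c1 + c2 + c3 + c4 + c5 + c6 + c7 + c8 + c9) (h6 : 6 ≤ n) (h5 : c5 ≤ 1)
    (h19 : c1 = 0 ∨ c9 = 0) (h28 : c2 = 0 ∨ c8 = 0) (h37 : c3 = 0 ∨ c7 = 0) (h46 : c4 = 0 ∨ c6 = 0)
    (hc1 : ¬1 ≤ c1) (hc9 : 1 ≤ c9) (hc4 : 1 ≤ c4) (hc7 : ¬1 ≤ c7) (hc3 : 1 ≤ c3) : 2 ≤ c4 := by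
  rcases h19 with hA | hA <;> rcases h28 with hB | hB <;> rcases h37 with hC | hC <;>
    rcases h46 with hD | hD <;> omega

/-- The arithmetic of `M₁₀` off the pairs, `x₉, x₄ ≥ 1`, `x₃ = x₇ = 0`: a multiple of `T₂ = {2,4,9}` (plus `5`s). [cite: Shioda1979PJA, §1 eq. (2)] -/
theorem ten_arith₇ {c1 c2 c3 c4 c5 c6 c7 c8 c9 n : ℕ}
    (hE1 : 2 * (c1 + 2 * c2 + 3 * c3 + 4 * c4 + 5 * c5 + 6 * c6 + 7 * c7 + 8 * c8 + 9 * c9) = 10 * n)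
    (hE3 : 2 * (3 * c1 + 6 * c2 + 9 * c3 + 2 * c4 + 5 * c5 + 8 * c6 + c7 + 4 * c8 + 7 * c9) = 10 * n)
    (hcard : n = c1 + c2 + c3 + c4 + c5 + c6 + c7 + c8 + c9) (_h6 : 6 ≤ n) (_h5 : c5 ≤ 1)
    (h19 : c1 = 0 ∨ c9 = 0) (h28 : c2 = 0 ∨ c8 = 0) (h37 : c3 = 0 ∨ c7 = 0) (h46 : c4 = 0 ∨ c6 = 0)
    (hc1 : ¬1 ≤ c1) (hc9 : 1 ≤ c9) (hc4 : 1 ≤ c4) (hc7 : ¬1 ≤ c7) (hc3 : ¬1 ≤ c3) : c1 = 0 ∧ c3 = 0 ∧ c6 = 0 ∧ c7 = 0 ∧ c8 = 0 ∧ c4 = c2 ∧ c9 = c2 := by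
  rcases h19 with hA | hA <;> rcases h28 with hB | hB <;> rcases h37 with hC | hC <;>
    rcases h46 with hD | hD <;> omega

/-- The arithmetic of `M₁₀` off the pairs, `x₉ ≥ 1`, `x₄ = 0`: `Q₃` occurs. [cite: Shioda1979PJA, §1 eq. (2)] -/
theorem ten_arith₈ {c1 c2 c3 c4 c5 c6 c7 c8 c9 n : ℕ}
    (hE1 : 2 * (c1 + 2 * c2 + 3 * c3 + 4 * c4 + 5 * c5 + 6 * c6 + 7 * c7 + 8 * c8 + 9 * c9) = 10 * n)
    (hE3 : 2 * (3 * c1 + 6 * c2 + 9 * c3 + 2 * c4 + 5 * c5 + 8 * c6 + c7 + 4 * c8 + 7 * c9) = 10 * n)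
    (hcard : n = c1 + c2 + c3 + c4 + c5 + c6 + c7 + c8 + c9) (h6 : 6 ≤ n) (h5 : c5 ≤ 1)
    (h19 : c1 = 0 ∨ c9 = 0) (h28 : c2 = 0 ∨ c8 = 0) (h37 : c3 = 0 ∨ c7 = 0) (h46 : c4 = 0 ∨ c6 = 0)
    (hc1 : ¬1 ≤ c1) (hc9 : 1 ≤ c9) (hc4 : ¬1 ≤ c4) : 2 ≤ c2 ∧ 1 ≤ c7 := by
  rcases h19 with hA | hA <;> rcases h28 with hB | hB <;> rcases h37 with hC | hC <;>
    rcases h46 with hD | hD <;> omega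

/-- The arithmetic of `M₁₀` off the pairs, `x₁ = x₉ = 0`, `x₂ ≥ 1`: a multiple of `T₃ = {2,6,7}` (plus `5`s). [cite: Shioda1979PJA, §1 eq. (2)] -/
theorem ten_arith₉ {c1 c2 c3 c4 c5 c6 c7 c8 c9 n : ℕ}
    (hE1 : 2 * (c1 + 2 * c2 + 3 * c3 + 4 * c4 + 5 * c5 + 6 * c6 + 7 * c7 + 8 * c8 + 9 * c9) = 10 * n)
    (hE3 : 2 * (3 * c1 + 6 * c2 + 9 * c3 + 2 * c4 + 5 * c5 + 8 * c6 + c7 + 4 * c8 + 7 * c9) = 10 * n)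
    (hcard : n = c1 + c2 + c3 + c4 + c5 + c6 + c7 + c8 + c9) (_h6 : 6 ≤ n) (_h5 : c5 ≤ 1)
    (h19 : c1 = 0 ∨ c9 = 0) (h28 : c2 = 0 ∨ c8 = 0) (h37 : c3 = 0 ∨ c7 = 0) (h46 : c4 = 0 ∨ c6 = 0)
    (hc1 : ¬1 ≤ c1) (hc9 : ¬1 ≤ c9) (hc2 : 1 ≤ c2) : c1 = 0 ∧ c3 = 0 ∧ c4 = 0 ∧ c8 = 0 ∧ c9 = 0 ∧ c6 = c2 ∧ c7 = c2 := by
  rcases h19 with hA | hA <;> rcases h28 with hB | hB <;> rcases h37 with hC | hC <;>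
    rcases h46 with hD | hD <;> omega

/-- The arithmetic of `M₁₀` off the pairs, `x₁ = x₉ = x₂ = 0`, `x₃ ≥ 1`: a multiple of `T₄ = {3,4,8}` (plus `5`s). [cite: Shioda1979PJA, §1 eq. (2)] -/
theorem ten_arith₁₀ {c1 c2 c3 c4 c5 c6 c7 c8 c9 n : ℕ}
    (hE1 : 2 * (c1 + 2 * c2 + 3 * c3 + 4 * c4 + 5 * c5 + 6 * c6 + 7 * c7 + 8 * c8 + 9 * c9) = 10 * n)
    (hE3 : 2 * (3 * c1 + 6 * c2 + 9 * c3 + 2 * c4 + 5 * c5 + 8 * c6 + c7 + 4 * c8 + 7 * c9) = 10 * n)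
    (hcard : n = c1 + c2 + c3 + c4 + c5 + c6 + c7 + c8 + c9) (_h6 : 6 ≤ n) (_h5 : c5 ≤ 1)
    (h19 : c1 = 0 ∨ c9 = 0) (h28 : c2 = 0 ∨ c8 = 0) (h37 : c3 = 0 ∨ c7 = 0) (h46 : c4 = 0 ∨ c6 = 0)
    (hc1 : ¬1 ≤ c1) (hc9 : ¬1 ≤ c9) (hc2 : ¬1 ≤ c2) (hc3 : 1 ≤ c3) : c1 = 0 ∧ c2 = 0 ∧ c6 = 0 ∧ c7 = 0 ∧ c9 = 0 ∧ c4 = c3 ∧ c8 = c3 := by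
  rcases h19 with hA | hA <;> rcases h28 with hB | hB <;> rcases h37 with hC | hC <;>
    rcases h46 with hD | hD <;> omega

/-- The arithmetic of `M₁₀` off the pairs, `x₁ = x₉ = x₂ = x₃ = 0`: nothing is left but at most one `5`. [cite: Shioda1979PJA, §1 eq. (2)] -/
theorem ten_arith₁₁ {c1 c2 c3 c4 c5 c6 c7 c8 c9 n : ℕ}
    (hE1 : 2 * (c1 + 2 * c2 + 3 * c3 + 4 * c4 + 5 * c5 + 6 * c6 + 7 * c7 + 8 * c8 + 9 * c9) = 10 * n)
    (hE3 : 2 * (3 * c1 + 6 * c2 + 9 * c3 + 2 * c4 + 5 * c5 + 8 * c6 + c7 + 4 * c8 + 7 * c9) = 10 * n)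
    (hcard : n = c1 + c2 + c3 + c4 + c5 + c6 + c7 + c8 + c9) (h6 : 6 ≤ n) (h5 : c5 ≤ 1)
    (h19 : c1 = 0 ∨ c9 = 0) (h28 : c2 = 0 ∨ c8 = 0) (h37 : c3 = 0 ∨ c7 = 0) (h46 : c4 = 0 ∨ c6 = 0)
    (hc1 : ¬1 ≤ c1) (hc9 : ¬1 ≤ c9) (hc2 : ¬1 ≤ c2) (hc3 : ¬1 ≤ c3) : False := by
  obtain rfl : c1 = 0 := by omega
  obtain rfl : c9 = 0 := by omega
  obtain rfl : c2 = 0 := by omega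
  obtain rfl : c3 = 0 := by omega
  rcases h46 with hD | hD <;> omega

/-- **`(P₁₀)`** (within Shioda's `m ≤ 20`, PJA Thm. 1 list item 2). Off the pairs and `{5,5}`, a
Hodge multiset over `ℤ/10` lies in one of eight two-parameter families `a·T + b·Q (+ {5})` with
`T ∈ {{1,6,8}, {2,4,9}, {2,6,7}, {3,4,8}}` a zero-sum triple and `Q ∈ {{1,3,8,8}, {1,6,6,7},
{2,2,7,9}, {3,4,4,9}}` an indecomposable of length `2` compatible with it; it then contains `Q`
(if `b ≥ 1`), or `T + {5}`, or `T + T` — the four indecomposables of length `3`, `2·T`, being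
quasi-decomposable (`+ {5,5} = (T + {5}) + (T + {5})`); `φ(10) = 3`.
[cite: Shioda1979PJA, §2 Thm. 1, list item 2)] -/
theorem shiodaCondition_ten : ShiodaCondition 10 := by
  intro s hs h6
  obtain ⟨h0, hE1, hE3, hcard⟩ := hs.count_of_ten
  obtain ⟨j, hj⟩ := hs.even_card
  have hn1 : (-1 : ZMod 10) = 9 := by decide
  have hn2 : (-2 : ZMod 10) = 8 := by decide
  have hn3 : (-3 : ZMod 10) = 7 := by decide
  have hn4 : (-4 : ZMod 10) = 6 := by decide
  have h4 : 4 ≤ card s := by omega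
  -- `{5, 5}` and the pairs
  by_cases h55 : 2 ≤ count 5 s
  · refine Or.inl (hs.isDecomposable_of_pair h4 (a := 5) (Multiset.count_pos.1 (by omega)) ?_)
    rw [if_pos (by decide)]
    exact h55
  have h5 : count 5 s ≤ 1 := by omega
  clear h55
  by_cases h19 : 1 ≤ count 1 s ∧ 1 ≤ count 9 s
  · refine Or.inl (hs.isDecomposable_of_pair h4 (a := 1) (Multiset.count_pos.1 h19.1) ?_)
    rw [if_neg (by decide), hn1]
    exact Multiset.count_pos.1 h19.2
  have h19' : count 1 s = 0 ∨ count 9 s = 0 := by omega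
  clear h19
  by_cases h28 : 1 ≤ count 2 s ∧ 1 ≤ count 8 s
  · refine Or.inl (hs.isDecomposable_of_pair h4 (a := 2) (Multiset.count_pos.1 h28.1) ?_)
    rw [if_neg (by decide), hn2]
    exact Multiset.count_pos.1 h28.2
  have h28' : count 2 s = 0 ∨ count 8 s = 0 := by omega
  clear h28
  by_cases h37 : 1 ≤ count 3 s ∧ 1 ≤ count 7 s
  · refine Or.inl (hs.isDecomposable_of_pair h4 (a := 3) (Multiset.count_pos.1 h37.1) ?_)
    rw [if_neg (by decide), hn3]
    exact Multiset.count_pos.1 h37.2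
  have h37' : count 3 s = 0 ∨ count 7 s = 0 := by omega
  clear h37
  by_cases h46 : 1 ≤ count 4 s ∧ 1 ≤ count 6 s
  · refine Or.inl (hs.isDecomposable_of_pair h4 (a := 4) (Multiset.count_pos.1 h46.1) ?_)
    rw [if_neg (by decide), hn4]
    exact Multiset.count_pos.1 h46.2
  have h46' : count 4 s = 0 ∨ count 6 s = 0 := by omega
  clear h46
  -- the eight families
  by_cases hc1 : 1 ≤ count 1 s
  · by_cases hc6 : 1 ≤ count 6 s
    · by_cases hc3 : 1 ≤ count 3 s
      · -- `T₁ + Q₁` family with `b ≥ 1`: contains `{1,3,8,8}`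
        have h8 : 2 ≤ count 8 s := ten_arith₁ hE1 hE3 hcard h6 h5 h19' h28' h37' h46' hc1 hc6 hc3
        exact Or.inl (hs.isDecomposable_of_le isHodgeMultiset_tenQ₁ (by decide)
          (tenQ₁_le hc1 hc3 h8) (show 4 < card s by omega))
      by_cases hc7 : 1 ≤ count 7 s
      · -- `T₁ + Q₂` or `T₃ + Q₂` with `b ≥ 1`: contains `{1,6,6,7}`
        have h66 : 2 ≤ count 6 s := ten_arith₂ hE1 hE3 hcard h6 h5 h19' h28' h37' h46' hc1 hc6 hc3 hc7
        exact Or.inl (hs.isDecomposable_of_le isHodgeMultiset_tenQ₂ (by decide)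
          (tenQ₂_le hc1 h66 hc7) (show 4 < card s by omega))
      -- pure `T₁`
      obtain ⟨hz2, hz3, hz4, hz7, hz9, he6, he8⟩ := ten_arith₃ hE1 hE3 hcard h6 h5 h19' h28' h37' h46' hc1 hc6 hc3 hc7
      exact ten_pureT₁ hs h6 h0 h5 hcard hz2 hz3 hz4 hz7 hz9 he6 he8
    · -- `x₁ ≥ 1`, `x₆ = 0`: `b·Q₁` or `T₄ + Q₁`: contains `{1,3,8,8}`
      obtain ⟨h3, h8⟩ := ten_arith₄ hE1 hE3 hcard h6 h5 h19' h28' h37' h46' hc1 hc6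
      exact Or.inl (hs.isDecomposable_of_le isHodgeMultiset_tenQ₁ (by decide)
        (tenQ₁_le hc1 h3 h8) (show 4 < card s by omega))
  by_cases hc9 : 1 ≤ count 9 s
  · by_cases hc4 : 1 ≤ count 4 s
    · by_cases hc7 : 1 ≤ count 7 s
      · -- `T₂ + Q₃` with `b ≥ 1`: contains `{2,2,7,9}`
        have h2 : 2 ≤ count 2 s := ten_arith₅ hE1 hE3 hcard h6 h5 h19' h28' h37' h46' hc1 hc9 hc4 hc7
        exact Or.inl (hs.isDecomposable_of_le isHodgeMultiset_tenQ₃ (by decide)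
          (tenQ₃_le h2 hc7 hc9) (show 4 < card s by omega))
      by_cases hc3 : 1 ≤ count 3 s
      · -- `T₂ + Q₄` or `T₄ + Q₄` with `b ≥ 1`: contains `{3,4,4,9}`
        have h44 : 2 ≤ count 4 s := ten_arith₆ hE1 hE3 hcard h6 h5 h19' h28' h37' h46' hc1 hc9 hc4 hc7 hc3
        exact Or.inl (hs.isDecomposable_of_le isHodgeMultiset_tenQ₄ (by decide)
          (tenQ₄_le hc3 h44 hc9) (show 4 < card s by omega))
      -- pure `T₂`
      obtain ⟨hz1, hz3, hz6, hz7, hz8, he4, he9⟩ := ten_arith₇ hE1 hE3 hcard h6 h5 h19' h28' h37' h46' hc1 hc9 hc4 hc7 hc3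
      exact ten_pureT₂ hs h6 h0 h5 hcard hz1 hz3 hz6 hz7 hz8 he4 he9
    · -- `x₉ ≥ 1`, `x₄ = 0`: contains `{2,2,7,9}`
      obtain ⟨h2, h7⟩ := ten_arith₈ hE1 hE3 hcard h6 h5 h19' h28' h37' h46' hc1 hc9 hc4
      exact Or.inl (hs.isDecomposable_of_le isHodgeMultiset_tenQ₃ (by decide)
        (tenQ₃_le h2 h7 hc9) (show 4 < card s by omega))
  -- `x₁ = x₉ = 0`: pure `T₃ = {2,6,7}` or pure `T₄ = {3,4,8}`
  by_cases hc2 : 1 ≤ count 2 s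
  · obtain ⟨hz1, hz3, hz4, hz8, hz9, he6, he7⟩ := ten_arith₉ hE1 hE3 hcard h6 h5 h19' h28' h37' h46' hc1 hc9 hc2
    exact ten_pureT₃ hs h6 h0 h5 hcard hz1 hz3 hz4 hz8 hz9 he6 he7
  by_cases hc3 : 1 ≤ count 3 s
  · obtain ⟨hz1, hz2, hz6, hz7, hz9, he4, he8⟩ := ten_arith₁₀ hE1 hE3 hcard h6 h5 h19' h28' h37' h46' hc1 hc9 hc2 hc3
    exact ten_pureT₄ hs h6 h0 h5 hcard hz1 hz2 hz6 hz7 hz9 he4 he8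
  exact (ten_arith₁₁ hE1 hE3 hcard h6 h5 h19' h28' h37' h46' hc1 hc9 hc2 hc3).elim

end Ten

end FermatCharacter

end Literature.AlgebraicGeometry.HodgeTheory

end
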